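import Literature.MathematicalPhysics.QuantumFieldTheory.Balaban1983to89.B2Lemma24KerOmegaTorus

/-!
# [B2] Lemma 2.4, proof p. 572, ON THE TORUS `T_η` — THE TORUS TRANSLATION LEMMA: [B4]'s operator (1.6), Green's
# function, averaging operator (1.4) and covariant derivative (1.3) of a torus region are COVARIANT under the
# translations of `T_η`; hence the Lemma 2.4 family of `B2Lemma24KerOmegaTorus` with the box `□₂` in ARBITRARY
# position on the torus (its representative may cross the seam of the period box), the seam normalisation of
# `B2Lemma24KerOmegaTorus.ModelV` (`0 ≤ o`, `o + M ≤ P`) PERFORMED IN THE KERNEL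

statement-level skeleton of published theorems with citation tags; proofs where landed; nothing here is a claim about
the Yang–Mills mass gap

**Sources.** T. Bałaban, *(Higgs)₂,₃ quantum fields in a finite volume. II. An upper bound*, Commun. Math. Phys. **86**
(1982) 555–594 (bib key `Balaban1982Higgs2`, «B2»; held `paper:balaban1982-cmp86-higgs23-ii`, journal page = PDF page +
554; text layer `p0016.txt`–`p0019.txt` = pp. 570–573 re-read by this seat): (2.56) p. 570, Proposition 2.2 (2.58)
pp. 570–571, Lemma 2.4 (2.65)–(2.67) p. 572; T. Bałaban, *Regularity and decay of lattice Green's functions*, Commun.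
Math. Phys. **89** (1983) 571–597 (bib key `Balaban1983RegularityDecay`, «B4»): p. 572 [PDF 2, L4–6] «Another common case
is to consider operators on subsets of a torus T_η which we identify with a rectangular parallelepiped in ηZ^d with
periodic conditions.», (1.1)–(1.7) p. 572, Theorem p. 573.  A NEW LEAF over `B2Lemma24KerOmegaTorus` (lit-balaban p23
g19, p341404/p341920/p342547: `ModelV`, `KΩT`, `dLT`, `toModelT`, `famOfV`, `lemma24Printed_modelV`, `FrameV`,
`kerΩ_far`, `kerΩ_near`, `dkerΩ_far`, `dkerΩ_near`) and, through it, over `B2Lemma24KerOmega` (p340291: `boxLabels`,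
`mem_boxLabels`, `shiftF`, `hnk`, `cutWt_true`, `block_mulVec_eq_fld`), r01's `B4TorusRegionOp` (p314051 ff.: `per`,
`twrap`, `blk_twrap`, `TNbr`, `torWt`, `torBond`, `torusOp`, `torusDeriv`, `tcovDeriv`, `perField`, `tnorm`,
`tnorm_add_per`, `val_mem_perBox`), `B4TorusPairFam` (`TorusPairInst`, `TorusPairInst.GT`/`DT`), `B4TorusPositivity`
(`wrap`, `wrap_wrap_add`, `wrap_eq_self_of_mem`, `wrap_mem_box`), `B4RegionCubeCarrier` (`boxEmb`, `boxEmbY`,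
`map_val_rstairContour`), p17's `B4CubeOpReindex.covOp_cut_submatrix`, b04's `B4GaugeCovariance` (`b4Op`, `covOp`,
`contourTrans`, `fieldLink`, `fld`), `B4Lower18Regular` (`stair`, `lsum`, `transport_fieldLink`), `B4Lower18RegularRegion`
(`rBlkWt`, `rbaseEmb`, `rstairContour`), `B4Prop31Holonomy.stair_add`, `B4SubBoxCarrier.lsum_map`, p23 g14's
`B2Prop22RegularRegionPair.avgQ`/`srcQ`/`single`, `B2Prop22RegularTorusPair.tsrc`/`tbond`, `B2Eq268GaugeAway.blkSite`,
`B2Lemma24Proof.{kerBox, dKer, lemma24_bounds}`; used BY NAME, nothing restated.  No existing module is touched, no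
definition of record altered, nothing of [B2]/[B4] asserted as a fact.  Unit `lit-balaban-p23` gen 20 (Phase-2 proof
seat p23), 2026-08-22; SKELETON row **B2.Lem2.4** (fold owner r02, second reader r14, referee ref-4; decl of record
`B2.Lemma24Printed`, head `proved p250408 · p336252 · p340291 · p341404` UNCHANGED — this file is a cells-only member);
successor item (a) of HOME/HANDOFF § p23 gen 19 = the second reader's «kernel block-multiple torus translation lemma»
(SECONDREAD-B2 v47) retiring HONEST SCOPE (c) `ho0`/`hoP` of `B2Lemma24KerOmegaTorus`.  v1.0 = p343655; v1.1 (this text):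
§5 APPENDED (§§1–4 byte-identical) — the source `f_{y,v} = Q_k^*(A)(vδ_y)` and `G_kf` under the relabelling BY NAME
(`fld_srcQ_shift`, `srcQ_shift`, `fld_green_mulVec_shift`, `fld_green_srcQ_shift`, `ModelW.toModelV_tsrc`,
`ModelW.toModelV_green_tsrc`), the fold owner's criterion (W2) naming `tsrc`.

## WHAT IS PRINTED (verbatim «…»)

[B4] p. 572 [PDF 2, L4–6]: «Another common case is to consider operators on subsets of a torus T_η which we identify
with a rectangular parallelepiped in ηZ^d with periodic conditions.»  [B2] p. 572 [PDF 18]: «Let us define □₁, □₂ as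
the sums of large blocks contained in Λ₇^{(k−1)′} and distant from the point y less than 2r(L^kε), 4r(L^kε)
respectively, and let us denote □ = B^k(□₂). Of course □ ⊂ B^k(Λ₂^{(k−1)′}). Using Proposition 2.2 and the restrictions
(2.55) we get φ^{(k)}(x) = (a_kG_k(□, A^{(k)})Q_k^*(A^{(k)})□₁φ)(x) + O((L^kε)^κ), x ∈ B^k(y), (2.67)»; (2.56) p. 570
[PDF 16]: «φ^{(k)} = a_kG_k(B^k(Λ₂^{(k−1)′}), A^{(k)})Q_k^*(A^{(k)})Λ₆^{(k−1)′}φ.»  The identification of `T_η` with a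
parallelepiped «with periodic conditions» is a choice of coordinates: the objects (1.1)–(1.7) of [B4] p. 572 (blocks,
bonds, `D^η_A`, `Q_k(A)`, `P_k(A)`, `−Δ^{η,N}_{A,Ω} + m² + a_kP_k(A)`, the regularity (1.7)) do not refer to the origin
of the parallelepiped.  Print places `□₂` around an arbitrary `y ∈ Λ₇^{(k−1)′}` of the torus; in the coordinates of
a fixed period box the representative `o + [0, M)` of `□₂` may cross the seam.

## DICTIONARY

As in `B2Lemma24KerOmegaTorus` (imported): the torus `T_η = Π_ν ℤ/(L^kP_ν)` (unit labels = representatives in the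
period box `Π_ν[0, P_ν)`, fine points = representatives in `Π_ν[0, L^kP_ν)`, reduction `twrap`, label reduction
`wrap P`), the outer region `Ω = B^k(Λ₂′)` given by its labels `Ω₀T`, the torus field `A^{(k)} = Ac` read on the
period box.  NEW: the TRANSLATION BY `t ∈ ℤ^{d+1}` (unit labels) of the torus: labels `y ↦ y + t mod P` (`tlab`),
fine points `x ↦ x + L^kt mod L^kP` (`tfin`), label sets `Ω ↦ Ω + t` (`shiftLabels`), fields
`A ↦ A(· − L^kt mod T)`; a box `□₂` of side `M` at the corner `o ∈ ℤ^{d+1}`: labels `(o + [0, M)) mod P` (the image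
of `boxDom M` under `tlab P o`), fine sites `B^k(□₂) ∋ x + L^ko mod T` for `x ∈ Π[0, L^kM)` (`tfin … o`).

## Main definitions and results

* §1 `tlab`, `shiftLabels`, `tfin` and their algebra (`tlab_neg_tlab`, `shiftLabels_neg_shiftLabels`, `blk_tfin`,
  `tfin_mem_fineDom`, `tfin_neg_tfin`, **`tfin_eq_add_of_blk`**: on a unit block the torus translation IS a lattice
  translation — a unit block never meets the seam); the relabelling maps `σT` (fine sites), `σY` (labels), bijective;
  `isBlockUnion_shiftLabels` (big-block unions translate by multiples of the big-block size), `tnorm_one_sub_wrap`.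
* §2 THE TORUS TRANSLATION LEMMA: `tNbr_tfin_iff`, `torWt_shift`, `torBond_shift`, `rBlkWt_shift`, `rbaseEmb_shift`,
  **`rstairContour_shift`** (staircase contours relabel: `stair_add` blockwise), `contourTrans_shift`,
  **`torusOp_shift`** (`H^T_k(Ω + t, A(· − L^kt))|_{σ×σ} = H^T_k(Ω, A)`, [B4] (1.6)), **`green_shift`** (the same for
  `G_k = H⁻¹`), `avgQ_shift` ((1.4)), `greenQ_shift_apply` (the kernel `G_k(Ω,A)Q_k(A)ᵀ` entrywise),
  **`fld_torusDeriv_shift`** ((1.3)).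
* §3 `ModelW` (= `ModelV` with the corner `o ∈ ℤ^{d+1}` free: NO `ho0`, NO `hoP`; `hbox` reads `(y + o) mod P ∈ Λ₂′`;
  «□₂ a sum of large blocks» as `K ∣ o`, `K ∣ M`; `M_μ < P_μ` kept), its translated data `ΩV`, `AcV`, `φV`, `ToutV`
  and **`toModelV : ModelV fr`** (the translation by `−o`, every hypothesis of `ModelV` DERIVED).
* §5 (v1.1) `fld_srcQ_shift`/`srcQ_shift` (the source `f_{y,v}` relabels), `fld_green_mulVec_shift` (`G_k` as an
  operator), `fld_green_srcQ_shift`, `ModelW.toModelV_tsrc`, `ModelW.toModelV_green_tsrc` (the normalised instance's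
  `tsrc` / `G_k·tsrc` at every site of `Ω` = the original).
* §4 THE IDENTIFICATIONS: `toModelV_ET` (the embedded box site is the relabelled `x + L^ko mod T`), **`toModelV_KΩT`**
  (the translated instance's outer kernel IS `K_Ω(x, y′) = a_k(G_k(Ω, A)Q_k^*(A))(x + L^ko mod T, y′)` of the ORIGINAL
  torus, `ModelW.KW`, `KW_mulVec`), `toModelV_AcP` (the box sees `A^{(k)}_per(· + L^ko)`), `toModelV_φ`, `toModelV_incT`,
  `φV_σY`, **`toModelV_φk`** (the (2.56) sum `Σ_{y′∈Λ₆′}K_Ω(x,y′)φ(y′)` of the normalised instance IS the original one),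
  `toModelV_dLT` (the label distance is `|y(x) + o − y′|_{T_1}`); the four (2.58) kernel bounds RESTATED for the original
  torus kernel (`kerΩ_far_W`, `dkerΩ_far_W`, `kerΩ_near_W`, `dkerΩ_near_W`); `famOfW`, head
  **`lemma24Printed_modelW (fr : FrameV ι d) : B2.Lemma24Printed (famOfW fr)`**.

## HONEST SCOPE

(a) CARRIER: as `B2Lemma24KerOmegaTorus` HONEST SCOPE (a) — `Ω = B^k(Λ₂′)` any union of big blocks of
`T_η = Π_ν ℤ/(L^kP_ν)`, the whole torus included — now with `□₂ = (o + [0, M)) mod P` for ANY `o ∈ ℤ^{d+1}` with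
`K ∣ o_μ`, `K ∣ M_μ` (print's «sums of large blocks»), `M_μ < P_μ` (print's `□₂` has diameter `8r(L^kε) ≪` the torus
side; `M_μ = P_μ` in some direction would make `□` a full circle of `T_η`, whose operator (1.6) has periodic, not
Neumann, bonds in that direction — genuinely outside the box lineage).  (b) SUB-FAMILY and (d) CONSTANTS, (e), (f):
verbatim as in the twin (`C` of `lemma24Printed_modelW` is the twin's `C`, a function of `fr.toFrame` alone).  (c) WHAT
REMAINS a hypothesis field of `ModelW`: the twin's list (c) MINUS `ho0`/`hoP` (the seam normalisation is now the
kernel's `toModelV`, a translation of `T_η` by `−o` under which [B4] (1.1)–(1.7) are PROVED covariant, §2) and with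
`hbigB` replaced by the divisibilities `hKo`/`hKM` (for a box these ARE «□₂ is a union of big blocks»): data, printed
hypotheses (`hreg` on `Ω`, torus differences; `hle`/`hleT`/`hleR`/`hθ1`/`hτ1`; scale products; (2.55) via `Restr`),
geometry (`hbox`, `hbigΩ`, `hKP`, `hMP`, `deep`/`hRT`/`hR4`/`hR1`, `far1`, `inc_mem`, `farΩ` — torus label distance
`|y(x) + o − y′|_{T_1} ≥ R₂` off `□₁`), `hMS`, `hM3`; the INTENDED INSTANCE (print's `y ∈ Λ₇′`, the `4r`/`2r` cubes,
`K₀ = M`; `B2Eq28RegionsBigBlockUnion`, `B2Eq267HiggsRegionAsPrinted`) is not derived inside the kernel here either.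
(g) The dev-quantities of `famOfW fr m` are, by DEFINITION, those of the translated instance `m.toModelV` (the twin's
`famOfV`); §4 proves that the kernel, fields and distances entering them are the original torus objects of `m` read
through the relabelling `σT`/`σY` — so `lemma24Printed_modelW` bounds (2.65)/(2.66) for `φ^{(k)}` of (2.56) on the
ORIGINAL torus data with the box around an arbitrary `y`.  Value = the Lemma 2.4 family of record covers `□₂` in any
position on `T_η`; NOT summit progress.
-/

namespace Literature.MathematicalPhysics.QuantumFieldTheory.Balaban1983to89.B2Lemma24KerOmegaTorusShift

open Finset Matrix
open Literature.MathematicalPhysics.QuantumFieldTheory.Balaban1983to89.B4GaugeCovariance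
open Literature.MathematicalPhysics.QuantumFieldTheory.Balaban1983to89.B4TorusPositivity (wrap box mem_box wrap_mem_box
  wrap_eq_self_of_mem wrap_wrap_add)
open Literature.MathematicalPhysics.QuantumFieldTheory.Balaban1983to89.B4Lower18 (fineDom mem_fineDom IsBlockUnion
  boxDom_isBlockUnion)
open Literature.MathematicalPhysics.QuantumFieldTheory.Balaban1983to89.B4Lower18Regular (e1 lsum stair mem_stair
  base_le_of_blk transport_fieldLink)
open Literature.MathematicalPhysics.QuantumFieldTheory.Balaban1983to89.B4Lower18RegularRegion (regWt rBlkWt rbaseEmb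
  rstairContour compField covOp_congr rBlkWt_ne_zero blk_of_between)
open Literature.MathematicalPhysics.QuantumFieldTheory.Balaban1983to89.B4Lemma21Region (siteNorm regionOp regionDeriv)
open Literature.MathematicalPhysics.QuantumFieldTheory.Balaban1983to89.B4Reflection242 (nbrs mem_nbrs boxDom mem_boxDom blk
  blk_mem_boxDom blk_mul)
open Literature.MathematicalPhysics.QuantumFieldTheory.Balaban1983to89.B4ContourShift (supNorm)
open Literature.MathematicalPhysics.QuantumFieldTheory.Balaban1983to89.B4Lemma22ReduceZero (Box)
open Literature.MathematicalPhysics.QuantumFieldTheory.Balaban1983to89.B4CubeOpReindex (cutWt covOp_cut_submatrix)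
open Literature.MathematicalPhysics.QuantumFieldTheory.Balaban1983to89.B4RegionCubeCarrier (boxEmb boxEmbY boxEmb_injective
  boxEmbY_injective blk_boxEmb map_val_rstairContour)
open Literature.MathematicalPhysics.QuantumFieldTheory.Balaban1983to89.B4Prop31Holonomy (stair_add)
open Literature.MathematicalPhysics.QuantumFieldTheory.Balaban1983to89.B4SubBoxCarrier (lsum_map)
open Literature.MathematicalPhysics.QuantumFieldTheory.Balaban1983to89.B4TwoBox120 (blk_add_mul)
open Literature.MathematicalPhysics.QuantumFieldTheory.Balaban1983to89.B4TorusRegionOp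
open Literature.MathematicalPhysics.QuantumFieldTheory.Balaban1983to89.B4TorusPairFam
open Literature.MathematicalPhysics.QuantumFieldTheory.Balaban1983to89.B2Eq268GaugeAway (blkSite)
open Literature.MathematicalPhysics.QuantumFieldTheory.Balaban1983to89.B2Lemma24Proof
open Literature.MathematicalPhysics.QuantumFieldTheory.Balaban1983to89.B2Lemma24RemD
open Literature.MathematicalPhysics.QuantumFieldTheory.Balaban1983to89.B2Lemma24SupG
open Literature.MathematicalPhysics.QuantumFieldTheory.Balaban1983to89.B2Lemma24KerOmega
open Literature.MathematicalPhysics.QuantumFieldTheory.Balaban1983to89.B2Lemma24KerOmegaTorus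
open Literature.MathematicalPhysics.QuantumFieldTheory.Balaban1983to89.B2Prop22RegularRegionPair (avgQ single srcQ
  fld_mul_avgQ_transpose_mulVec_single)
open Literature.MathematicalPhysics.QuantumFieldTheory.Balaban1983to89.B2Prop22RegularTorusPair (tsrc tbond tbase tldist
  one_le_nT)

noncomputable section

variable {d : ℕ} {ι : Type} [Fintype ι] [DecidableEq ι]

/-! ## §1 Translations of the torus: labels, label sets, fine points; the relabelling maps -/

section Shift

variable (P : Fin (d + 1) → ℕ) (t : Fin (d + 1) → ℤ)

omit [Fintype ι] [DecidableEq ι]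

/-- the translation `y ↦ y + t mod P` of the unit labels of the torus (representatives in the period box).
[cite: Balaban1983RegularityDecay, p. 572 «a rectangular parallelepiped … with periodic conditions», dictionary] -/
def tlab (y : Fin (d + 1) → ℤ) : Fin (d + 1) → ℤ := wrap P (y + t)

/-- the translated label set `Ω + t mod P`. [cite: Balaban1983RegularityDecay, p. 572 «periodic conditions», dictionary] -/
def shiftLabels (Ω : Finset (Fin (d + 1) → ℤ)) : Finset (Fin (d + 1) → ℤ) := Ω.image (tlab P t)

/-- the translation `x ↦ x + L^kt mod L^kP` of the fine points of the torus (representatives in the fine period box).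
[cite: Balaban1983RegularityDecay, (1.1) p. 572, p. 572 «periodic conditions», dictionary] -/
def tfin (n : ℕ) (z : Fin (d + 1) → ℤ) : Fin (d + 1) → ℤ := twrap n P (z + fun ν => (n : ℤ) * t ν)

/-- a label reduction differs from the label by a period vector. [cite: Balaban1983RegularityDecay, p. 572 «periodic conditions», dictionary] -/
theorem wrap_eq_add (z : Fin (d + 1) → ℤ) : ∃ s : Fin (d + 1) → ℤ, wrap P z = z + fun ν => (P ν : ℤ) * s ν := by
  refine ⟨fun ν => -(z ν / (P ν : ℤ)), funext fun ν => ?_⟩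
  simp only [wrap, Pi.add_apply]
  linarith [Int.mul_ediv_add_emod (z ν) (P ν : ℤ)]

/-- label reduction is blind to period vectors. [cite: Balaban1983RegularityDecay, p. 572 «periodic conditions», dictionary] -/
theorem wrap_add_mulP (z s : Fin (d + 1) → ℤ) : wrap P (z + fun ν => (P ν : ℤ) * s ν) = wrap P z := by
  funext ν
  simp only [wrap, Pi.add_apply]
  exact Int.add_mul_emod_self_left _ _ _

/-- a reduced label lies in the period box. [cite: Balaban1983RegularityDecay, p. 572 «periodic conditions», dictionary] -/
theorem wrap_mem_boxDom (hP : ∀ ν, 1 ≤ P ν) (z : Fin (d + 1) → ℤ) : wrap P z ∈ boxDom P := by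
  rw [← box_eq_boxDom]; exact wrap_mem_box hP z

/-- labels of the period box are their own reductions. [cite: Balaban1983RegularityDecay, p. 572 «periodic conditions», dictionary] -/
theorem wrap_of_mem {z : Fin (d + 1) → ℤ} (hz : z ∈ boxDom P) : wrap P z = z :=
  wrap_eq_self_of_mem (by rw [box_eq_boxDom]; exact hz)

/-- the translated label lies in the period box. [cite: Balaban1983RegularityDecay, p. 572 «periodic conditions», dictionary] -/
theorem tlab_mem_boxDom (hP : ∀ ν, 1 ≤ P ν) (y : Fin (d + 1) → ℤ) : tlab P t y ∈ boxDom P := wrap_mem_boxDom P hP _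

/-- translating back: `((y + t) mod P) − t mod P = y` for a representative `y`. [cite: Balaban1983RegularityDecay, p. 572 «periodic conditions», dictionary] -/
theorem tlab_neg_tlab {y : Fin (d + 1) → ℤ} (hy : y ∈ boxDom P) : tlab P (-t) (tlab P t y) = y := by
  unfold tlab
  rw [wrap_wrap_add, show y + t + -t = y by abel, wrap_of_mem P hy]

/-- translating forth: `((y − t) mod P) + t mod P = y`. [cite: Balaban1983RegularityDecay, p. 572 «periodic conditions», dictionary] -/
theorem tlab_tlab_neg {y : Fin (d + 1) → ℤ} (hy : y ∈ boxDom P) : tlab P t (tlab P (-t) y) = y := by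
  have h := tlab_neg_tlab P (-t) hy
  rwa [neg_neg] at h

/-- the label translation is injective on representatives. [cite: Balaban1983RegularityDecay, p. 572 «periodic conditions», dictionary] -/
theorem tlab_inj {y y' : Fin (d + 1) → ℤ} (hy : y ∈ boxDom P) (hy' : y' ∈ boxDom P) (h : tlab P t y = tlab P t y') :
    y = y' := by
  rw [← tlab_neg_tlab P t hy, ← tlab_neg_tlab P t hy', h]

/-- membership in the translated label set. [cite: Balaban1983RegularityDecay, p. 572 «periodic conditions», dictionary] -/
theorem mem_shiftLabels {Ω : Finset (Fin (d + 1) → ℤ)} {y' : Fin (d + 1) → ℤ} :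
    y' ∈ shiftLabels P t Ω ↔ ∃ y ∈ Ω, tlab P t y = y' := Finset.mem_image

/-- a translated label of `Ω` is a label of `Ω + t`. [cite: Balaban1983RegularityDecay, p. 572 «periodic conditions», dictionary] -/
theorem tlab_mem_shiftLabels {Ω : Finset (Fin (d + 1) → ℤ)} {y : Fin (d + 1) → ℤ} (hy : y ∈ Ω) :
    tlab P t y ∈ shiftLabels P t Ω := Finset.mem_image_of_mem _ hy

/-- the translated label set lies in the period box. [cite: Balaban1983RegularityDecay, p. 572 «periodic conditions», dictionary] -/
theorem shiftLabels_subset (hP : ∀ ν, 1 ≤ P ν) (Ω : Finset (Fin (d + 1) → ℤ)) : shiftLabels P t Ω ⊆ boxDom P := by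
  intro y' hy'
  obtain ⟨y, -, rfl⟩ := (mem_shiftLabels P t).1 hy'
  exact tlab_mem_boxDom P t hP y

/-- a label whose translate is a label of `Ω + t` is a label of `Ω` (representatives). [cite: Balaban1983RegularityDecay, p. 572 «periodic conditions», dictionary] -/
theorem mem_of_tlab_mem {Ω : Finset (Fin (d + 1) → ℤ)} (hΩ : Ω ⊆ boxDom P) {y : Fin (d + 1) → ℤ} (hy : y ∈ boxDom P)
    (h : tlab P t y ∈ shiftLabels P t Ω) : y ∈ Ω := by
  obtain ⟨y₀, hy₀, he⟩ := (mem_shiftLabels P t).1 h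
  rwa [← tlab_inj P t (hΩ hy₀) hy he]

/-- translating a label set back. [cite: Balaban1983RegularityDecay, p. 572 «periodic conditions», dictionary] -/
theorem shiftLabels_neg_shiftLabels {Ω : Finset (Fin (d + 1) → ℤ)} (hΩ : Ω ⊆ boxDom P) :
    shiftLabels P (-t) (shiftLabels P t Ω) = Ω := by
  ext y
  constructor
  · intro hy
    obtain ⟨y', hy', rfl⟩ := (mem_shiftLabels P (-t)).1 hy
    obtain ⟨y₀, hy₀, rfl⟩ := (mem_shiftLabels P t).1 hy'
    rwa [tlab_neg_tlab P t (hΩ hy₀)]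
  · intro hy
    exact (mem_shiftLabels P (-t)).2 ⟨tlab P t y, tlab_mem_shiftLabels P t hy, tlab_neg_tlab P t (hΩ hy)⟩

/-- translating a label set forth. [cite: Balaban1983RegularityDecay, p. 572 «periodic conditions», dictionary] -/
theorem shiftLabels_shiftLabels_neg {Ω : Finset (Fin (d + 1) → ℤ)} (hΩ : Ω ⊆ boxDom P) :
    shiftLabels P t (shiftLabels P (-t) Ω) = Ω := by
  have h := shiftLabels_neg_shiftLabels P (-t) hΩ
  rwa [neg_neg] at h

/-- a label of `Ω − t` translates into `Ω`. [cite: Balaban1983RegularityDecay, p. 572 «periodic conditions», dictionary] -/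
theorem tlab_mem_of_mem_shiftLabels_neg {Ω : Finset (Fin (d + 1) → ℤ)} (hΩ : Ω ⊆ boxDom P) {y' : Fin (d + 1) → ℤ}
    (hy' : y' ∈ shiftLabels P (-t) Ω) : tlab P t y' ∈ Ω := by
  have h := tlab_mem_shiftLabels P t hy'
  rwa [shiftLabels_shiftLabels_neg P t hΩ] at h

variable {n : ℕ} (hn : 1 ≤ n)

include hn in
/-- **THE BLOCK OF THE TRANSLATED FINE POINT IS THE TRANSLATED BLOCK LABEL** (`blk_twrap`: unit blocks do not meet the
seam). [cite: Balaban1983RegularityDecay, (1.1) p. 572 «B^k(y)», p. 572 «periodic conditions», dictionary] -/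
theorem blk_tfin (z : Fin (d + 1) → ℤ) : blk n (tfin P t n z) = tlab P t (blk n z) := by
  rw [tfin, blk_twrap hn, blk_add_mul hn]
  rfl

include hn in
/-- a translated fine point of `Ω` is a fine point of `Ω + t`. [cite: Balaban1983RegularityDecay, (1.1) p. 572, dictionary] -/
theorem tfin_mem_fineDom {Ω : Finset (Fin (d + 1) → ℤ)} {z : Fin (d + 1) → ℤ} (hz : z ∈ fineDom n Ω) :
    tfin P t n z ∈ fineDom n (shiftLabels P t Ω) := by
  rw [mem_fineDom hn, blk_tfin P t hn]
  exact tlab_mem_shiftLabels P t ((mem_fineDom hn).1 hz)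

include hn in
/-- the translated fine point is a representative. [cite: Balaban1983RegularityDecay, p. 572 «periodic conditions», dictionary] -/
theorem tfin_mem_perBox (hP : ∀ ν, 1 ≤ P ν) (z : Fin (d + 1) → ℤ) : tfin P t n z ∈ boxDom (per n P) :=
  twrap_mem_boxDom hn hP _

/-- translating a fine representative back. [cite: Balaban1983RegularityDecay, p. 572 «periodic conditions», dictionary] -/
theorem tfin_neg_tfin {z : Fin (d + 1) → ℤ} (hz : z ∈ boxDom (per n P)) : tfin P (-t) n (tfin P t n z) = z := by
  unfold tfin
  rw [twrap_twrap_add, show (z + fun ν => (n : ℤ) * t ν) + (fun ν => (n : ℤ) * (-t) ν) = z by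
    funext ν; simp only [Pi.add_apply, Pi.neg_apply]; ring, twrap_eq_self hz]

/-- translating a fine representative forth. [cite: Balaban1983RegularityDecay, p. 572 «periodic conditions», dictionary] -/
theorem tfin_tfin_neg {z : Fin (d + 1) → ℤ} (hz : z ∈ boxDom (per n P)) : tfin P t n (tfin P (-t) n z) = z := by
  have h := tfin_neg_tfin P (-t) (n := n) hz
  rwa [neg_neg] at h

/-- the fine translation is injective on representatives. [cite: Balaban1983RegularityDecay, p. 572 «periodic conditions», dictionary] -/
theorem tfin_inj {z z' : Fin (d + 1) → ℤ} (hz : z ∈ boxDom (per n P)) (hz' : z' ∈ boxDom (per n P))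
    (h : tfin P t n z = tfin P t n z') : z = z' := by
  rw [← tfin_neg_tfin P t hz, ← tfin_neg_tfin P t hz', h]

/-- a torus step then a translation = the translation then the step: `(x + e mod T) + nt mod T = (x + nt mod T) + e mod T`.
[cite: Balaban1983RegularityDecay, (1.3) p. 572, p. 572 «periodic conditions», dictionary] -/
theorem tfin_twrap_add (z v : Fin (d + 1) → ℤ) : tfin P t n (twrap n P (z + v)) = twrap n P (tfin P t n z + v) := by
  unfold tfin
  rw [twrap_twrap_add, twrap_twrap_add, add_right_comm]

include hn in
/-- **ON A UNIT BLOCK THE TORUS TRANSLATION IS A LATTICE TRANSLATION**: for `z ∈ B(y)`,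
`z + nt mod T = z + n·((y + t mod P) − y)` — the block `B(y)` is carried rigidly onto the block of the representative
`(y + t) mod P` (a unit block never meets the seam of the period box). [cite: Balaban1983RegularityDecay, (1.1) p. 572
«B^k(y)», p. 572 «periodic conditions», dictionary] -/
theorem tfin_eq_add_of_blk (hP : ∀ ν, 1 ≤ P ν) {z y : Fin (d + 1) → ℤ} (hz : blk n z = y) :
    tfin P t n z = z + fun ν => (n : ℤ) * (tlab P t y - y) ν := by
  obtain ⟨s, hs⟩ := wrap_eq_add P (y + t)
  have htl : tlab P t y = y + t + fun ν => (P ν : ℤ) * s ν := hs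
  -- the candidate representative
  set w : Fin (d + 1) → ℤ := z + fun ν => (n : ℤ) * (tlab P t y - y) ν with hw
  have hblk : blk n w = tlab P t y := by
    rw [hw, blk_add_mul hn, hz]; abel
  have hwbox : w ∈ boxDom (per n P) := by
    have hmem : w ∈ fineDom n (boxDom P) := by
      rw [mem_fineDom hn, hblk]; exact tlab_mem_boxDom P t hP y
    exact val_mem_perBox hn (Finset.Subset.refl _) ⟨w, hmem⟩
  have hper : w = (z + fun ν => (n : ℤ) * t ν) + fun ν => (per n P ν : ℤ) * s ν := by
    rw [hw, htl]
    funext ν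
    simp only [Pi.add_apply, Pi.sub_apply, per, Nat.cast_mul]
    ring
  rw [tfin, ← twrap_eq_self hwbox, hper, twrap_add_per]

variable (Ω : Finset (Fin (d + 1) → ℤ))

/-- THE RELABELLING OF THE FINE SITES of a torus region under the translation by `t`. [cite: Balaban1983RegularityDecay, (1.1) p. 572, p. 572 «periodic conditions», dictionary] -/
def σT (x : ↥(fineDom n Ω)) : ↥(fineDom n (shiftLabels P t Ω)) := ⟨tfin P t n x.1, tfin_mem_fineDom P t hn x.2⟩

/-- THE RELABELLING OF THE UNIT LABELS of a torus region under the translation by `t`. [cite: Balaban1983RegularityDecay, (1.1) p. 572, dictionary] -/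
def σY (y : ↥Ω) : ↥(shiftLabels P t Ω) := ⟨tlab P t y.1, tlab_mem_shiftLabels P t y.2⟩

/-- `σT` on values. [cite: Balaban1983RegularityDecay, (1.1) p. 572, dictionary] -/
@[simp] theorem σT_val (x : ↥(fineDom n Ω)) : (σT P t hn Ω x).1 = tfin P t n x.1 := rfl

/-- `σY` on values. [cite: Balaban1983RegularityDecay, (1.1) p. 572, dictionary] -/
@[simp] theorem σY_val (y : ↥Ω) : (σY P t Ω y).1 = tlab P t y.1 := rfl

variable {Ω} (hΩ : Ω ⊆ boxDom P)

include hΩ in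
/-- `σT` is injective. [cite: Balaban1983RegularityDecay, (1.1) p. 572, dictionary] -/
theorem σT_injective : Function.Injective (σT P t hn Ω) := fun x x' h =>
  Subtype.ext (tfin_inj P t (val_mem_perBox hn hΩ x) (val_mem_perBox hn hΩ x') (congrArg Subtype.val h))

include hΩ in
/-- `σY` is injective. [cite: Balaban1983RegularityDecay, (1.1) p. 572, dictionary] -/
theorem σY_injective : Function.Injective (σY P t Ω) := fun y y' h =>
  Subtype.ext (tlab_inj P t (hΩ y.2) (hΩ y'.2) (congrArg Subtype.val h))

include hΩ in
/-- `σT` is onto. [cite: Balaban1983RegularityDecay, (1.1) p. 572, dictionary] -/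
theorem σT_surjective (hP : ∀ ν, 1 ≤ P ν) : Function.Surjective (σT P t hn Ω) := by
  intro w
  have hwrep : w.1 ∈ boxDom (per n P) := val_mem_perBox hn (shiftLabels_subset P t hP Ω) w
  have hz : tfin P (-t) n w.1 ∈ fineDom n Ω := by
    have h := tfin_mem_fineDom P (-t) hn w.2
    rwa [shiftLabels_neg_shiftLabels P t hΩ] at h
  exact ⟨⟨tfin P (-t) n w.1, hz⟩, Subtype.ext (tfin_tfin_neg P t hwrep)⟩

include hΩ in
/-- `σY` is onto. [cite: Balaban1983RegularityDecay, (1.1) p. 572, dictionary] -/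
theorem σY_surjective (hP : ∀ ν, 1 ≤ P ν) : Function.Surjective (σY P t Ω) := by
  intro w
  have hwrep : w.1 ∈ boxDom P := shiftLabels_subset P t hP Ω w.2
  have hz : tlab P (-t) w.1 ∈ Ω := by
    have h := tlab_mem_shiftLabels P (-t) w.2
    rwa [shiftLabels_neg_shiftLabels P t hΩ] at h
  exact ⟨⟨tlab P (-t) w.1, hz⟩, Subtype.ext (tlab_tlab_neg P t hwrep)⟩

/-- `σT` as an equivalence. [cite: Balaban1983RegularityDecay, (1.1) p. 572, dictionary] -/
def σTquiv (hP : ∀ ν, 1 ≤ P ν) : ↥(fineDom n Ω) ≃ ↥(fineDom n (shiftLabels P t Ω)) :=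
  Equiv.ofBijective (σT P t hn Ω) ⟨σT_injective P t hn hΩ, σT_surjective P t hn hΩ hP⟩

/-- `σY` as an equivalence. [cite: Balaban1983RegularityDecay, (1.1) p. 572, dictionary] -/
def σYquiv (hP : ∀ ν, 1 ≤ P ν) : ↥Ω ≃ ↥(shiftLabels P t Ω) :=
  Equiv.ofBijective (σY P t Ω) ⟨σY_injective P t hΩ, σY_surjective P t hΩ hP⟩

variable (ι) in
/-- `σT × id` on sites × colours. [cite: Balaban1983RegularityDecay, (1.1) p. 572, dictionary] -/
def σTι (hP : ∀ ν, 1 ≤ P ν) : (↥(fineDom n Ω) × ι) ≃ (↥(fineDom n (shiftLabels P t Ω)) × ι) :=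
  (σTquiv P t hn hΩ hP).prodCongr (Equiv.refl ι)

variable (ι) in
/-- `σY × id` on labels × colours. [cite: Balaban1983RegularityDecay, (1.1) p. 572, dictionary] -/
def σYι (hP : ∀ ν, 1 ≤ P ν) : (↥Ω × ι) ≃ (↥(shiftLabels P t Ω) × ι) :=
  (σYquiv P t hΩ hP).prodCongr (Equiv.refl ι)

/-- `σTι = σT × id`. [cite: Balaban1983RegularityDecay, (1.1) p. 572, dictionary] -/
theorem σTι_eq (hP : ∀ ν, 1 ≤ P ν) : ⇑(σTι ι P t hn hΩ hP) = Prod.map (σT P t hn Ω) id := by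
  funext p; rfl

/-- `σYι = σY × id`. [cite: Balaban1983RegularityDecay, (1.1) p. 572, dictionary] -/
theorem σYι_eq (hP : ∀ ν, 1 ≤ P ν) : ⇑(σYι ι P t hΩ hP) = Prod.map (σY P t Ω) id := by
  funext p; rfl

/-! ### Big-block unions and torus distances under translations -/

/-- the box `Π[0, P)` with `K ∣ P_ν` written as a box of `K`-blocks. [cite: Balaban1983RegularityDecay, p. 575 «Ω is a sum of the corresponding large blocks», dictionary] -/
theorem boxDom_eq_of_dvd {K : ℕ} (hKP : ∀ ν, K ∣ P ν) : boxDom P = boxDom (fun ν => K * (P ν / K)) := by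
  congr 1
  funext ν
  exact (Nat.mul_div_cancel' (hKP ν)).symm

/-- the fine period of `K`-blocks over `P/K` labels is `P`. [cite: Balaban1983RegularityDecay, p. 575, dictionary] -/
theorem per_div_eq {K : ℕ} (hKP : ∀ ν, K ∣ P ν) : per K (fun ν => P ν / K) = P := by
  funext ν
  exact Nat.mul_div_cancel' (hKP ν)

/-- `K`-block labels of reduced labels: `blk K (w mod P) = (blk K w) mod (P/K)` for `K ∣ P`. [cite: Balaban1983RegularityDecay, (1.1) p. 572, p. 575, dictionary] -/
theorem blk_wrap_of_dvd {K : ℕ} (hK : 1 ≤ K) (hKP : ∀ ν, K ∣ P ν) (w : Fin (d + 1) → ℤ) :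
    blk K (wrap P w) = wrap (fun ν => P ν / K) (blk K w) := by
  have h := blk_twrap hK (fun ν => P ν / K) w
  rwa [twrap, per_div_eq P hKP] at h

include hΩ in
/-- **BIG-BLOCK UNIONS TRANSLATE** by multiples of the big-block size: `Ω + t mod P` is a union of `K`-blocks when `Ω`
is, `K ∣ P_ν` and `K ∣ t_ν`. [cite: Balaban1983RegularityDecay, p. 575 «We have assumed that Ω^{(k)} is a sum of large
blocks … thus Ω is a sum of the corresponding large blocks of the size M on η-lattice T_η», dictionary] -/
theorem isBlockUnion_shiftLabels {K : ℕ} (hK : 1 ≤ K) (hKP : ∀ ν, K ∣ P ν) (hKt : ∀ ν, (K : ℤ) ∣ t ν)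
    (h : IsBlockUnion K Ω) : IsBlockUnion K (shiftLabels P t Ω) := by
  set P' : Fin (d + 1) → ℕ := fun ν => P ν / K with hP'
  set t' : Fin (d + 1) → ℤ := fun ν => t ν / (K : ℤ) with ht'
  have htK : t = fun ν => (K : ℤ) * t' ν := by
    funext ν; exact (Int.mul_ediv_cancel' (hKt ν)).symm
  intro x hx z hz
  obtain ⟨x₀, hx₀, rfl⟩ := (mem_shiftLabels P t).1 hx
  have hx₀P : x₀ ∈ boxDom P := hΩ hx₀
  have hP1 : ∀ ν, 1 ≤ P ν := fun ν => by have := (mem_boxDom.1 hx₀P) ν; omega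
  -- `z` lies in the period box (it shares a `K`-block with a point of the box, `K ∣ P`)
  have hzP : z ∈ boxDom P := by
    have hxP : tlab P t x₀ ∈ boxDom (fun ν => K * (P ν / K)) := by
      rw [← boxDom_eq_of_dvd P hKP]; exact tlab_mem_boxDom P t hP1 x₀
    rw [boxDom_eq_of_dvd P hKP]
    exact boxDom_isBlockUnion hK _ hxP hz
  -- the back-translate `z₀ = (z − t) mod P` of `z` lies in `Ω`
  have hblkx : blk K (tlab P t x₀) = wrap P' (blk K x₀ + t') := by
    rw [tlab, blk_wrap_of_dvd P hK hKP, htK, blk_add_mul hK]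
  have hblkz₀ : blk K (tlab P (-t) z) = blk K x₀ := by
    rw [tlab, blk_wrap_of_dvd P hK hKP, show z + -t = z + fun ν => (K : ℤ) * (-t') ν by
      rw [htK]; funext ν; simp only [Pi.add_apply, Pi.neg_apply]; ring, blk_add_mul hK, hz, hblkx,
      ← hP', wrap_wrap_add, show blk K x₀ + t' + -t' = blk K x₀ by abel]
    rw [boxDom_eq_of_dvd P hKP] at hx₀P
    exact wrap_of_mem P' (blk_mem_boxDom hK hx₀P)
  have hz₀ : tlab P (-t) z ∈ Ω := h hx₀ hblkz₀
  exact (mem_shiftLabels P t).2 ⟨tlab P (-t) z, hz₀, tlab_tlab_neg P t hzP⟩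

/-- the labels `[0, M)` of a box are `boxLabels M 0`. [cite: Balaban1982Higgs2, p. 572 «□ = B^k(□₂)», dictionary] -/
theorem boxLabels_zero (M : Fin (d + 1) → ℕ) : boxLabels M 0 = boxDom M := by
  ext y
  simp only [mem_boxLabels, mem_boxDom, Pi.zero_apply, zero_add]

/-- a box `Π[0, M)` with `K ∣ M_i` is a union of `K`-blocks. [cite: Balaban1982Higgs2, p. 572 «□₂ … the sums of large blocks», dictionary] -/
theorem isBlockUnion_boxLabels_zero {K : ℕ} (hK : 1 ≤ K) {M : Fin (d + 1) → ℕ} (hKM : ∀ i, K ∣ M i) :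
    IsBlockUnion K (boxLabels M 0) := by
  rw [boxLabels_zero, boxDom_eq_of_dvd M hKM]
  exact boxDom_isBlockUnion hK _

/-- **THE UNIT-TORUS DISTANCE IS BLIND TO LABEL REDUCTION**: `|b − (w mod P)|_{T_1} = |b − w|_{T_1}`.
[cite: Balaban1983RegularityDecay, p. 572 «periodic conditions»; Balaban1982Higgs2, (2.58) p. 570 «dist(b, y)», dictionary] -/
theorem tnorm_one_sub_wrap (b w : Fin (d + 1) → ℤ) : tnorm 1 P (b - wrap P w) = tnorm 1 P (b - w) := by
  obtain ⟨s, hs⟩ := wrap_eq_add P w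
  rw [hs, show b - (w + fun ν => (P ν : ℤ) * s ν) = (b - w) + fun ν => (per 1 P ν : ℤ) * (-s) ν by
    funext ν; simp only [Pi.sub_apply, Pi.add_apply, Pi.neg_apply, per, one_mul]; ring, tnorm_add_per]

end Shift

/-! ## §2 THE TORUS TRANSLATION LEMMA: (1.3), (1.4), (1.6) and `G_k` are covariant under the relabelling -/

section Covariance

variable {n : ℕ} (hn : 1 ≤ n) (P : Fin (d + 1) → ℕ) (hP : ∀ ν, 1 ≤ P ν) (t : Fin (d + 1) → ℤ)
  {Ω : Finset (Fin (d + 1) → ℤ)} (hΩ : Ω ⊆ boxDom P)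
  (Ac Ac' : (Fin (d + 1) → ℤ) → Fin (d + 1) → ℝ) (hA : ∀ z ∈ boxDom (per n P), Ac' (tfin P t n z) = Ac z)

omit [Fintype ι] [DecidableEq ι] in
include hn hP in
/-- **TORUS BONDS RELABEL**: `x + nt mod T` and `x′ + nt mod T` form the torus bond `⟨·, · + e_μ⟩` iff `x`, `x′` do.
[cite: Balaban1983RegularityDecay, (1.3) p. 572 «bonds», p. 572 «periodic conditions», dictionary] -/
theorem eq_twrap_tfin_iff {u v : Fin (d + 1) → ℤ} (hv : v ∈ boxDom (per n P)) (μ : Fin (d + 1)) :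
    tfin P t n v = twrap n P (tfin P t n u + e1 μ) ↔ v = twrap n P (u + e1 μ) := by
  rw [← tfin_twrap_add P t]
  constructor
  · intro h
    exact tfin_inj P t hv (twrap_mem_boxDom hn hP _) h
  · intro h
    rw [← h]

omit [Fintype ι] [DecidableEq ι] in
include hn hP in
/-- the torus nearest-neighbour relation relabels. [cite: Balaban1983RegularityDecay, (1.3) p. 572, dictionary] -/
theorem tNbr_tfin_iff {u v : Fin (d + 1) → ℤ} (hu : u ∈ boxDom (per n P)) (hv : v ∈ boxDom (per n P)) :
    TNbr n P (tfin P t n u) (tfin P t n v) ↔ TNbr n P u v := by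
  unfold TNbr
  simp only [eq_twrap_tfin_iff hn P hP t hv, eq_twrap_tfin_iff hn P hP t hu]

omit [Fintype ι] [DecidableEq ι] in
include hP hΩ in
/-- **THE BOND WEIGHTS (1.3) RELABEL**. [cite: Balaban1983RegularityDecay, (1.3) p. 572, p. 572 «periodic conditions»] -/
theorem torWt_shift (u v : ↥(fineDom n Ω)) :
    torWt n P (fineDom n (shiftLabels P t Ω)) (σT P t hn Ω u) (σT P t hn Ω v) = torWt n P (fineDom n Ω) u v := by
  unfold torWt
  rw [σT_val, σT_val, tNbr_tfin_iff hn P hP t (val_mem_perBox hn hΩ u) (val_mem_perBox hn hΩ v)]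

omit [Fintype ι] [DecidableEq ι] in
include hn hP hA in
/-- **THE TORUS FIELD AS A BOND FUNCTION RELABELS**: `A′_{⟨σx, σx′⟩} = A_{⟨x, x′⟩}` for the relabelled field
`A′(x + nt) = A(x)`. [cite: Balaban1983RegularityDecay, p. 572 «A_{⟨x,x+ηe_μ⟩} = A_μ(x)», p. 572 «periodic conditions»] -/
theorem torBond_shift {u v : Fin (d + 1) → ℤ} (hu : u ∈ boxDom (per n P)) (hv : v ∈ boxDom (per n P)) :
    torBond n P Ac' (tfin P t n u) (tfin P t n v) = torBond n P Ac u v := by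
  unfold torBond
  simp only [eq_twrap_tfin_iff hn P hP t hv, eq_twrap_tfin_iff hn P hP t hu, hA u hu, hA v hv]

omit [Fintype ι] [DecidableEq ι] in
include hΩ in
/-- **THE BLOCK WEIGHTS (1.4) RELABEL**: `1[σx ∈ B(σy)] = 1[x ∈ B(y)]`. [cite: Balaban1983RegularityDecay, (1.4) p. 572, dictionary] -/
theorem rBlkWt_shift (y : ↥Ω) (x : ↥(fineDom n Ω)) :
    rBlkWt n (shiftLabels P t Ω) (fineDom n (shiftLabels P t Ω)) (σY P t Ω y) (σT P t hn Ω x)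
      = rBlkWt n Ω (fineDom n Ω) y x := by
  unfold rBlkWt
  rw [σT_val, σY_val, blk_tfin P t hn]
  by_cases h : blk n x.1 = y.1
  · rw [if_pos h, if_pos (by rw [h])]
  · rw [if_neg h, if_neg (fun h' => h (tlab_inj P t (hΩ ((mem_fineDom hn).1 x.2)) (hΩ y.2) h'))]

omit [Fintype ι] [DecidableEq ι] in
include hP in
/-- **THE BASE CORNERS RELABEL**: `σ(n·y) = n·σ(y)`. [cite: Balaban1983RegularityDecay, (1.4) p. 572 «Γ^{(k)}_{y,x}», dictionary] -/
theorem rbaseEmb_shift (y : ↥Ω) :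
    σT P t hn Ω (rbaseEmb hn Ω y) = rbaseEmb hn (shiftLabels P t Ω) (σY P t Ω y) := by
  apply Subtype.ext
  rw [σT_val]
  show tfin P t n (fun i => (n : ℤ) * y.1 i) = fun i => (n : ℤ) * (tlab P t y.1) i
  rw [tfin_eq_add_of_blk P t hn hP (blk_mul hn y.1)]
  funext i
  simp only [Pi.add_apply, Pi.sub_apply]
  ring

omit [Fintype ι] [DecidableEq ι] in
include hP hΩ in
/-- **THE STAIRCASE CONTOURS RELABEL**: `Γ_{σy, σx} = σ ∘ Γ_{y,x}` — on the block `B(y)` the relabelling is the lattice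
translation by `n((y + t mod P) − y)` (`tfin_eq_add_of_blk`), and staircases translate (`stair_add`).
[cite: Balaban1983RegularityDecay, (1.4) p. 572 «Γ^{(k)}_{y,x}», p. 572 «periodic conditions»] -/
theorem rstairContour_shift (y : ↥Ω) (x : ↥(fineDom n Ω)) :
    rstairContour hn (shiftLabels P t Ω) (σY P t Ω y) (σT P t hn Ω x) = (rstairContour hn Ω y x).map (σT P t hn Ω) := by
  apply List.map_injective_iff.2 Subtype.val_injective
  rw [List.map_map, map_val_rstairContour, show Subtype.val ∘ σT P t hn Ω = tfin P t n ∘ Subtype.val from rfl,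
    ← List.map_map, map_val_rstairContour, σT_val, σY_val, blk_tfin P t hn]
  by_cases hb : blk n x.1 = y.1
  · rw [if_pos (by rw [hb]), if_pos hb]
    set c : Fin (d + 1) → ℤ := fun ν => (n : ℤ) * (tlab P t y.1 - y.1) ν with hc
    have hx : tfin P t n x.1 = x.1 + c := tfin_eq_add_of_blk P t hn hP hb
    have hbase : (fun i => (n : ℤ) * tlab P t y.1 i) = (fun i => (n : ℤ) * y.1 i) + c := by
      funext i; simp only [hc, Pi.add_apply, Pi.sub_apply]; ring
    rw [hx, hbase, stair_add]
    apply List.map_congr_left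
    intro z hz
    have hle := base_le_of_blk hn hb
    have hzb : blk n z = y.1 := blk_of_between hn hb (mem_stair hle.1 hz).1 (mem_stair hle.1 hz).2
    exact (tfin_eq_add_of_blk P t hn hP hzb).symm
  · rw [if_neg (fun h' => hb (tlab_inj P t (hΩ ((mem_fineDom hn).1 x.2)) (hΩ y.2) h')), if_neg hb]
    rfl

include hP hΩ hA in
/-- **THE BLOCK TRANSPORTERS (1.4) RELABEL**: `U(A′(Γ_{σy,σx})) = U(A(Γ_{y,x}))`. [cite: Balaban1983RegularityDecay, (1.4) p. 572 «U(A(Γ^{(k)}_{y,x}))», p. 572 «periodic conditions»] -/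
theorem contourTrans_shift (F : OrthFlow ι) (κ : ℝ) (y : ↥Ω) (x : ↥(fineDom n Ω)) :
    contourTrans (fieldLink F κ fun a b : ↥(fineDom n (shiftLabels P t Ω)) => torBond n P Ac' a.1 b.1)
        (rbaseEmb hn (shiftLabels P t Ω)) (rstairContour hn (shiftLabels P t Ω)) (σY P t Ω y) (σT P t hn Ω x)
      = contourTrans (fieldLink F κ fun a b : ↥(fineDom n Ω) => torBond n P Ac a.1 b.1) (rbaseEmb hn Ω)
          (rstairContour hn Ω) y x := by
  unfold contourTrans
  rw [transport_fieldLink, transport_fieldLink, rstairContour_shift hn P hP t hΩ, ← rbaseEmb_shift hn P hP t, lsum_map]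
  congr 3
  funext a b
  simp only [σT_val]
  exact torBond_shift hn P hP t Ac Ac' hA (val_mem_perBox hn hΩ a) (val_mem_perBox hn hΩ b)

include hP hΩ hA in
/-- **THE TORUS TRANSLATION LEMMA FOR (1.6)**: `H^T_k(Ω + t, A′)|_{σ × σ} = H^T_k(Ω, A)` — [B4]'s operator
`−Δ^{η,N}_{A,Ω} + m² + a_kP_k(A)` on a torus region, built at the translated region from the relabelled field and read
through the relabelling `σT`, IS the operator of the region: torus bonds, bond weights, block weights, base corners,
staircase contours, link variables and transporters all relabel (p17's `covOp_cut_submatrix` with nothing cut).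
[cite: Balaban1983RegularityDecay, (1.3)–(1.6) p. 572 «operators on subsets of a torus T_η … with periodic conditions»] -/
theorem torusOp_shift (F : OrthFlow ι) (e a m2 : ℝ) :
    (torusOp F e hn a m2 P (shiftLabels P t Ω) Ac').submatrix (Prod.map (σT P t hn Ω) id) (Prod.map (σT P t hn Ω) id)
      = torusOp F e hn a m2 P Ω Ac := by
  set Ω' := shiftLabels P t Ω with hΩ'
  have hS : ∀ z : ↥(fineDom n Ω'), True ↔ ∃ a, σT P t hn Ω a = z :=
    fun z => ⟨fun _ => σT_surjective P t hn hΩ hP z, fun _ => trivial⟩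
  have hmain := covOp_cut_submatrix (fun _ => True) (σT_injective P t hn hΩ) hS (σY_injective P t hΩ)
    (torWt n P (fineDom n Ω')) m2 (a * ((n : ℝ) ^ (d + 1))⁻¹) (rBlkWt n Ω' (fineDom n Ω'))
    (fieldLink F (e / n) fun a b : ↥(fineDom n Ω') => torBond n P Ac' a.1 b.1)
    (contourTrans (fieldLink F (e / n) fun a b : ↥(fineDom n Ω') => torBond n P Ac' a.1 b.1) (rbaseEmb hn Ω')
      (rstairContour hn Ω'))
    (fun y b h => by
      obtain ⟨y', hy'⟩ := σY_surjective P t hΩ hP y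
      exact ⟨y', hy'⟩)
  rw [cutWt_true] at hmain
  have hc : (fun b b' => torWt n P (fineDom n Ω') (σT P t hn Ω b) (σT P t hn Ω b')) = torWt n P (fineDom n Ω) := by
    funext b b'; exact torWt_shift hn P hP t hΩ b b'
  have hq : (fun y' b => rBlkWt n Ω' (fineDom n Ω') (σY P t Ω y') (σT P t hn Ω b)) = rBlkWt n Ω (fineDom n Ω) := by
    funext y' b; exact rBlkWt_shift hn P t hΩ y' b
  have hW : (fun b b' => fieldLink F (e / n) (fun a b : ↥(fineDom n Ω') => torBond n P Ac' a.1 b.1)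
      (σT P t hn Ω b) (σT P t hn Ω b'))
      = fieldLink F (e / n) (fun a b : ↥(fineDom n Ω) => torBond n P Ac a.1 b.1) := by
    funext b b'
    simp only [fieldLink, σT_val]
    rw [torBond_shift hn P hP t Ac Ac' hA (val_mem_perBox hn hΩ b) (val_mem_perBox hn hΩ b')]
  have hT : (fun y' b => contourTrans (fieldLink F (e / n) fun a b : ↥(fineDom n Ω') => torBond n P Ac' a.1 b.1)
      (rbaseEmb hn Ω') (rstairContour hn Ω') (σY P t Ω y') (σT P t hn Ω b))
      = contourTrans (fieldLink F (e / n) fun a b : ↥(fineDom n Ω) => torBond n P Ac a.1 b.1) (rbaseEmb hn Ω)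
          (rstairContour hn Ω) := by
    funext y' b; exact contourTrans_shift hn P hP t hΩ Ac Ac' hA F (e / n) y' b
  show (b4Op F (e / n) _ m2 _ _ _ _ _).submatrix _ _ = b4Op F (e / n) _ m2 _ _ _ _ _
  rw [b4Op, b4Op, hmain, hc, hq, hW, hT]

include hP hΩ hA in
/-- **THE TORUS TRANSLATION LEMMA FOR `G_k(Ω, A)`**: `G_k(Ω + t, A′)|_{σ × σ} = G_k(Ω, A)` (the inverse commutes with the
reindexing along a bijection). [cite: Balaban1983RegularityDecay, (1.6) p. 572 «G_k(Ω, A)», p. 572 «periodic conditions»] -/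
theorem green_shift (F : OrthFlow ι) (e a m2 : ℝ) :
    ((torusOp F e hn a m2 P (shiftLabels P t Ω) Ac')⁻¹).submatrix (Prod.map (σT P t hn Ω) id) (Prod.map (σT P t hn Ω) id)
      = (torusOp F e hn a m2 P Ω Ac)⁻¹ := by
  rw [← torusOp_shift hn P hP t hΩ Ac Ac' hA F e a m2, ← σTι_eq P t hn hΩ hP, Matrix.inv_submatrix_equiv]

include hP hΩ hA in
/-- **THE TORUS TRANSLATION LEMMA FOR `Q_k(A)` (1.4)**: `Q_k(A′)|_{σY × σT} = Q_k(A)` on the torus regions.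
[cite: Balaban1983RegularityDecay, (1.4) p. 572 «(Q_k(A)φ)(y) = Σ … U(A(Γ^{(k)}_{y,x}))φ(x)», p. 572 «periodic conditions»] -/
theorem avgQ_shift (F : OrthFlow ι) (κ : ℝ) :
    (avgQ F κ hn (shiftLabels P t Ω) fun a b : ↥(fineDom n (shiftLabels P t Ω)) => torBond n P Ac' a.1 b.1).submatrix
        (Prod.map (σY P t Ω) id) (Prod.map (σT P t hn Ω) id)
      = avgQ F κ hn Ω fun a b : ↥(fineDom n Ω) => torBond n P Ac a.1 b.1 := by
  ext ⟨y', i⟩ ⟨b, j⟩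
  simp only [Matrix.submatrix_apply, Prod.map_apply, id_eq, avgQ, avgOp, blockOp_apply]
  rw [rBlkWt_shift hn P t hΩ, contourTrans_shift hn P hP t hΩ Ac Ac' hA]

include hP hΩ hA in
/-- **THE KERNEL `G_k(Ω,A)Q_k(A)ᵀ` RELABELS ENTRYWISE**: its `(σx, σy)` entry at `(Ω + t, A′)` is its `(x, y)` entry at
`(Ω, A)` (`Matrix.submatrix_mul_equiv`). [cite: Balaban1982Higgs2, (2.56) p. 570, (2.58) p. 570; Balaban1983RegularityDecay, (1.4)–(1.6) p. 572] -/
theorem greenQ_shift_apply (F : OrthFlow ι) (e a m2 : ℝ) (x : ↥(fineDom n Ω)) (y : ↥Ω) (i j : ι) :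
    ((torusOp F e hn a m2 P (shiftLabels P t Ω) Ac')⁻¹
        * (avgQ F (e / n) hn (shiftLabels P t Ω) fun a b : ↥(fineDom n (shiftLabels P t Ω)) => torBond n P Ac' a.1 b.1)ᵀ)
        (σT P t hn Ω x, i) (σY P t Ω y, j)
      = ((torusOp F e hn a m2 P Ω Ac)⁻¹ * (avgQ F (e / n) hn Ω fun a b : ↥(fineDom n Ω) => torBond n P Ac a.1 b.1)ᵀ)
          (x, i) (y, j) := by
  rw [← green_shift hn P hP t hΩ Ac Ac' hA F e a m2, ← avgQ_shift hn P hP t hΩ Ac Ac' hA F (e / n),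
    Matrix.transpose_submatrix, ← σTι_eq P t hn hΩ hP, ← σYι_eq P t hΩ hP, Matrix.submatrix_mul_equiv]
  rfl

include hP hΩ hA in
/-- **THE TORUS TRANSLATION LEMMA FOR `D^η_{A,μ}` (1.3)**: `(D^η_{A′,μ}Φ)(σx) = (D^η_{A,μ}(Φ ∘ σ))(x)`.
[cite: Balaban1983RegularityDecay, (1.3) p. 572 «(D^η_{A,μ}φ)(x) = η^{−1}(U(A_{⟨x,x+ηe_μ⟩})φ(x + ηe_μ) − φ(x))», p. 572 «periodic conditions»] -/
theorem fld_torusDeriv_shift (F : OrthFlow ι) (e : ℝ) (μ : Fin (d + 1))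
    (Φ : ↥(fineDom n (shiftLabels P t Ω)) × ι → ℝ) (x : ↥(fineDom n Ω)) :
    fld (torusDeriv F e n P (shiftLabels P t Ω) Ac' μ *ᵥ Φ) (σT P t hn Ω x)
      = fld (torusDeriv F e n P Ω Ac μ *ᵥ fun p => Φ (σT P t hn Ω p.1, p.2)) x := by
  have hx : x.1 ∈ boxDom (per n P) := val_mem_perBox hn hΩ x
  have hstep : twrap n P ((σT P t hn Ω x).1 + e1 μ) = tfin P t n (twrap n P (x.1 + e1 μ)) := by
    rw [σT_val, tfin_twrap_add]
  by_cases hmem : twrap n P (x.1 + e1 μ) ∈ fineDom n Ω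
  · have hmem' : twrap n P ((σT P t hn Ω x).1 + e1 μ) ∈ fineDom n (shiftLabels P t Ω) := by
      rw [hstep]; exact tfin_mem_fineDom P t hn hmem
    rw [torusDeriv, torusDeriv, fld_tcovDeriv_mulVec_of_mem _ _ _ _ hmem', fld_tcovDeriv_mulVec_of_mem _ _ _ _ hmem]
    have hpt : (⟨twrap n P ((σT P t hn Ω x).1 + e1 μ), hmem'⟩ : ↥(fineDom n (shiftLabels P t Ω)))
        = σT P t hn Ω ⟨twrap n P (x.1 + e1 μ), hmem⟩ := Subtype.ext hstep
    rw [hpt]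
    have hrep : twrap n P (x.1 + e1 μ) ∈ boxDom (per n P) := val_mem_perBox hn hΩ ⟨_, hmem⟩
    have hlink : fieldLink F (e / n) (fun u v : ↥(fineDom n (shiftLabels P t Ω)) => torBond n P Ac' u.1 v.1)
        (σT P t hn Ω x) (σT P t hn Ω ⟨twrap n P (x.1 + e1 μ), hmem⟩)
        = fieldLink F (e / n) (fun u v : ↥(fineDom n Ω) => torBond n P Ac u.1 v.1) x ⟨twrap n P (x.1 + e1 μ), hmem⟩ := by
      simp only [fieldLink, σT_val]
      rw [torBond_shift hn P hP t Ac Ac' hA hx hrep]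
    rw [hlink]
    rfl
  · have hmem' : twrap n P ((σT P t hn Ω x).1 + e1 μ) ∉ fineDom n (shiftLabels P t Ω) := by
      rw [hstep]
      intro h
      apply hmem
      have h2 := tfin_mem_fineDom P (-t) hn h
      rwa [shiftLabels_neg_shiftLabels P t hΩ, tfin_neg_tfin P t (twrap_mem_boxDom hn hP _)] at h2
    rw [torusDeriv, torusDeriv, fld_tcovDeriv_mulVec_of_not_mem _ _ _ _ hmem',
      fld_tcovDeriv_mulVec_of_not_mem _ _ _ _ hmem]

end Covariance

/-! ## §3 The instance with `□₂` in arbitrary position on the torus; its translation by `−o` -/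

section Instance

variable [Nonempty ι] {d : ℕ}

/-- **ONE INSTANCE OF LEMMA 2.4 ON THE BOX LINEAGE WITH ITS OUTER REGION ON THE TORUS, THE BOX `□₂` AT AN ARBITRARY
CORNER `o ∈ ℤ^{d+1}`** (labels `(o + [0, M)) mod P ⊆ Λ₂′`; the representative may cross the seam of the period box):
the fields of `B2Lemma24KerOmegaTorus.ModelV` WITHOUT `ho0`/`hoP`, the containment `hbox` read modulo `P`, and «`□₂` a
sum of large blocks» as `K ∣ o_μ`, `K ∣ M_μ` (`hKo`, `hKM`, replacing `hbigB`); `M_μ < P_μ` (a proper sub-box) kept.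
[cite: Balaban1982Higgs2, (2.55)–(2.56) p. 570, Prop. 2.2 (2.58) pp. 570–571, p. 571 sentence after (2.60), Lemma 2.4 and
its proof p. 572 «Let us define □₁, □₂ as the sums of large blocks … distant from the point y less than 2r(L^kε),
4r(L^kε)»; Balaban1983RegularityDecay, p. 572 «a rectangular parallelepiped … with periodic conditions», (1.7) p. 572, §2 p. 575] -/
structure ModelW (fr : FrameV ι d) where
  k : ℕ
  hk : 1 ≤ k
  a : ℝ
  m2 : ℝ
  ha1 : fr.amin ≤ a
  ha2 : a ≤ fr.aplus
  hm1 : 0 ≤ m2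
  hm2 : m2 ≤ fr.m2plus
  M : Fin (d + 1) → ℕ
  hM : ∀ i, 1 ≤ M i
  hMS : ∀ i, M i ≤ fr.S
  hM3 : ∀ i, 3 ≤ (fr.ℓ + 1) ^ k * M i
  /-- the torus `T_η = Π_ν ℤ/(L^kP_ν)`: `P_ν` unit blocks in direction `ν` -/
  P : Fin (d + 1) → ℕ
  /-- the big blocks divide the torus -/
  hKP : ∀ ν, fr.KV1 ∣ P ν
  /-- the lower corner of `□₂` in the unit torus: ANY integer vector (no seam normalisation) -/
  o : Fin (d + 1) → ℤ
  /-- `□₂` is a sum of big blocks: corner and sides are multiples of the big-block size -/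
  hKo : ∀ i, (fr.KV1 : ℤ) ∣ o i
  hKM : ∀ i, fr.KV1 ∣ M i
  /-- `□₂` is a PROPER sub-box of the torus (not a full circle in any direction) -/
  hMP : ∀ i, M i < P i
  /-- the unit labels of `Ω = B^k(Λ₂^{(k−1)′})` (representatives in the period box) -/
  Ω₀T : Finset (Fin (d + 1) → ℤ)
  hΩP : Ω₀T ⊆ boxDom P
  /-- `□₂ ⊂ Λ₂′`: the labels `(y + o) mod P`, `y ∈ Π[0, M)`, lie in `Λ₂′` -/
  hbox : ∀ y : ↥(boxDom M), wrap P (y.1 + o) ∈ Ω₀T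
  /-- `Ω` is a union of big blocks -/
  hbigΩ : IsBlockUnion fr.KV1 Ω₀T
  e : ℝ
  he : 0 < e
  hle : e ≤ fr.eNC1
  hleT : e ≤ fr.eT1
  hleR : e ≤ fr.eR1
  hθ1 : thetaS d fr.S fr.creg fr.β e ≤ 1
  hτ1 : ((d : ℝ) + 1) * thetaS d fr.S fr.creg fr.β e ≤ 1
  /-- the torus component field `A^{(k)}_ν(x)` on the period box of the fine torus -/
  Ac : (Fin (d + 1) → ℤ) → Fin (d + 1) → ℝ
  /-- (2.23)/(1.7) on `Ω = B^k(Λ₂′)`, torus forward differences -/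
  hreg : ∀ x ∈ fineDom ((fr.ℓ + 1) ^ k) Ω₀T, ∀ μ ν : Fin (d + 1),
    |Ac (twrap ((fr.ℓ + 1) ^ k) P (x + e1 μ)) ν - Ac x ν| ≤ fr.creg * e ^ (fr.β - 1) / ((fr.ℓ + 1) ^ k : ℕ)
  x₀ : ↥(Box d fr.ℓ k M)
  y : ↥(boxDom M)
  sq1 : Finset ↥(boxDom M)
  y_mem : y ∈ sq1
  /-- `φ` on the unit sites of `Λ₂′` -/
  φΩ : ↥Ω₀T → ι → ℝ
  p : ℝ
  q : ℝ
  tφ : ℝ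
  R₁ : ℝ
  R₂ : ℝ
  R₄ : ℝ
  p_nonneg : 0 ≤ p
  q_nonneg : 0 ≤ q
  tφ_nonneg : 0 ≤ tφ
  R₂_nonneg : 0 ≤ R₂
  q_le : q ≤ fr.K₃ * p
  kap : m2 / (B1.aSeq a ((fr.ℓ : ℝ) + 1) k + m2) * tφ ≤ fr.K₁
  sepG : Real.exp (-(fr.dG * R₁)) * tφ ≤ fr.K₂
  sepD : Real.exp (-(fr.dD * R₁)) * tφ ≤ fr.K₂
  sepO₂ : Real.exp (-(fr.δO / 2 * R₂)) * tφ ≤ fr.K₄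
  sepO₄ : Real.exp (-(fr.δO * R₄)) * tφ ≤ fr.K₅
  θ_scale : thetaS d fr.S fr.creg fr.β e * tφ ≤ fr.Kθ
  τ_scale : ((d : ℝ) + 1) * thetaS d fr.S fr.creg fr.β e * tφ ≤ fr.Kτ
  θ'_scale : fr.creg * e ^ fr.β * tφ ≤ fr.Kθ'
  far1 : ∀ x : ↥(Box d fr.ℓ k M), blkSite d fr.ℓ k M x = y → ∀ x' : ↥(Box d fr.ℓ k M), blkSite d fr.ℓ k M x' ∉ sq1 →
    R₁ ≤ supNorm (x.1 - x'.1) / (((fr.ℓ + 1) ^ k : ℕ) : ℝ)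
  /-- the unit sites of `Λ₆′ ⊂ Λ₂′` carrying `φ` in (2.56) -/
  Tout : Finset ↥Ω₀T
  /-- `□₁ ⊂ Λ₆′`: the labels `(y′ + o) mod P`, `y′ ∈ □₁`, carry `φ` -/
  inc_mem : ∀ y' ∈ sq1, (⟨wrap P (y'.1 + o), hbox y'⟩ : ↥Ω₀T) ∈ Tout
  /-- the sites of (2.56) off `□₁` are at torus label distance `≥ R₂` from `B^k(y)` -/
  farΩ : ∀ x : ↥(Box d fr.ℓ k M), blkSite d fr.ℓ k M x = y → ∀ y' ∈ Tout,
    y' ∉ sq1.image (fun y'' : ↥(boxDom M) => (⟨wrap P (y''.1 + o), hbox y''⟩ : ↥Ω₀T)) →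
    R₂ ≤ tnorm 1 P ((blkSite d fr.ℓ k M x).1 + o - y'.1)
  R : ℕ
  hR1 : 1 ≤ R
  deep : ∀ x : ↥(Box d fr.ℓ k M), blkSite d fr.ℓ k M x = y →
    ∀ i, ((R * (fr.ℓ + 1) ^ k : ℕ) : ℤ) ≤ x.1 i ∧ x.1 i + (R * (fr.ℓ + 1) ^ k : ℕ) + 1 ≤ (((fr.ℓ + 1) ^ k * M i : ℕ) : ℤ)
  /-- the printed restriction of (2.58): `dist_T(x, □^c) ≥ R₀` on `B^k(y)` -/
  hRT : fr.rT1 ≤ R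
  /-- `dist_T(x, □^c) ≥ R₄` on `B^k(y)` -/
  hR4 : R₄ ≤ R

namespace ModelW

variable {fr : FrameV ι d} (m : ModelW fr)

/-- the running coefficient `a_k`. [cite: Balaban1982Higgs2, (2.56) p. 570] -/
abbrev ak : ℝ := B1.aSeq m.a ((fr.ℓ : ℝ) + 1) m.k

/-- the torus sizes of a proper box: `P_ν ≥ 1` and the fine period `L^kP_ν ≥ 3` (from `1 ≤ M_ν < P_ν`, `L ≥ 2`,
`k ≥ 1`; r01's torus-family hypotheses). [cite: Balaban1983RegularityDecay, p. 572 «a torus T_η … with periodic conditions», dictionary] -/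
theorem hP3 : (∀ ν, 1 ≤ m.P ν) ∧ ∀ ν, 3 ≤ per ((fr.ℓ + 1) ^ m.k) m.P ν := by
  refine ⟨fun ν => Nat.one_le_of_lt (m.hMP ν), fun ν => ?_⟩
  have hP2 : 2 ≤ m.P ν := Nat.succ_le_of_lt (lt_of_le_of_lt (m.hM ν) (m.hMP ν))
  have hL2 : 2 ≤ (fr.ℓ + 1) ^ m.k :=
    le_trans (by simpa using Nat.succ_le_succ fr.hℓ) (Nat.le_self_pow (Nat.one_le_iff_ne_zero.1 m.hk) (fr.ℓ + 1))
  show 3 ≤ (fr.ℓ + 1) ^ m.k * m.P ν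
  nlinarith

include m in
/-- the big-block size is positive (`K ∣ P_ν ≥ 1`). [cite: Balaban1983RegularityDecay, p. 575 «large blocks of the size M», dictionary] -/
theorem hK1 : 1 ≤ fr.KV1 := by
  rcases Nat.eq_zero_or_pos fr.KV1 with h | h
  · exfalso
    have h1 := m.hKP 0
    rw [h] at h1
    have h2 := Nat.eq_zero_of_zero_dvd h1
    have h3 := m.hP3.1 0
    omega
  · exact h

/-- the labels `[0, M)` of `□₂` (own coordinates) are labels of the period box. [cite: Balaban1983RegularityDecay, p. 572, dictionary] -/
theorem boxDom_M_subset : boxDom m.M ⊆ boxDom m.P := fun y hy => by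
  rw [mem_boxDom] at hy ⊢
  intro i
  exact ⟨(hy i).1, lt_trans (hy i).2 (by exact_mod_cast m.hMP i)⟩

/-- the fine box `Π[0, L^kM)` lies in the fine period box. [cite: Balaban1983RegularityDecay, (1.1) p. 572, dictionary] -/
theorem box_subset_perBox {x : Fin (d + 1) → ℤ} (hx : x ∈ Box d fr.ℓ m.k m.M) :
    x ∈ boxDom (per ((fr.ℓ + 1) ^ m.k) m.P) := by
  rw [Box, mem_boxDom] at hx
  rw [mem_boxDom]
  intro i
  refine ⟨(hx i).1, lt_of_lt_of_le (hx i).2 ?_⟩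
  simp only [per]
  exact_mod_cast Nat.mul_le_mul_left _ (m.hMP i).le

/-! ### The translated data -/

/-- the translated outer labels `Λ₂′ − o mod P`. [cite: Balaban1983RegularityDecay, p. 572 «periodic conditions», dictionary] -/
def ΩV : Finset (Fin (d + 1) → ℤ) := shiftLabels m.P (-m.o) m.Ω₀T

/-- the translated torus field `A^{(k)}(· + L^ko mod T_η)`. [cite: Balaban1983RegularityDecay, p. 572 «A_{⟨x,x+ηe_μ⟩} = A_μ(x)», dictionary] -/
def AcV : (Fin (d + 1) → ℤ) → Fin (d + 1) → ℝ := fun z => m.Ac (tfin m.P m.o ((fr.ℓ + 1) ^ m.k) z)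

/-- the field seen from the box: `A^{(k)}_per(· + L^ko)` (the original field, periodically extended, translated).
[cite: Balaban1982Higgs2, (2.67) p. 572; Balaban1983RegularityDecay, p. 572 «periodic conditions», dictionary] -/
abbrev AcPW : (Fin (d + 1) → ℤ) → Fin (d + 1) → ℝ := shiftF fr.ℓ m.k m.o (perField ((fr.ℓ + 1) ^ m.k) m.P m.Ac)

/-- the label of `Λ₂′` carrying the box label `y′ ∈ □₂`: `(y′ + o) mod P`. [cite: Balaban1982Higgs2, p. 572 «□ ⊂ B^k(Λ₂^{(k−1)′})», dictionary] -/
def incW (y' : ↥(boxDom m.M)) : ↥m.Ω₀T := ⟨wrap m.P (y'.1 + m.o), m.hbox y'⟩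

/-- `φ` read on the translated labels. [cite: Balaban1982Higgs2, (2.56) p. 570, dictionary] -/
def φV (y' : ↥m.ΩV) : ι → ℝ := m.φΩ ⟨tlab m.P m.o y'.1, tlab_mem_of_mem_shiftLabels_neg m.P m.o m.hΩP y'.2⟩

/-- the relabelling `Λ₂′ ↪ Λ₂′ − o` of the unit labels. [cite: Balaban1983RegularityDecay, p. 572 «periodic conditions», dictionary] -/
def ιV : ↥m.Ω₀T ↪ ↥m.ΩV := ⟨σY m.P (-m.o) m.Ω₀T, σY_injective m.P (-m.o) m.hΩP⟩

/-- the translated outer sites `Λ₆′ − o`. [cite: Balaban1982Higgs2, (2.56) p. 570, dictionary] -/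
def ToutV : Finset ↥m.ΩV := m.Tout.map m.ιV

/-- `ιV` acts as `σY`. [cite: Balaban1983RegularityDecay, p. 572, dictionary] -/
@[simp] theorem ιV_apply (y' : ↥m.Ω₀T) : m.ιV y' = σY m.P (-m.o) m.Ω₀T y' := rfl

/-- the translated labels lie in the period box. [cite: Balaban1983RegularityDecay, p. 572, dictionary] -/
theorem hΩV : m.ΩV ⊆ boxDom m.P := shiftLabels_subset m.P (-m.o) m.hP3.1 m.Ω₀T

/-- translating the carried label back: `((y′ + o) mod P) − o mod P = y′`. [cite: Balaban1983RegularityDecay, p. 572 «periodic conditions», dictionary] -/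
theorem tlab_neg_incW (y' : ↥(boxDom m.M)) : tlab m.P (-m.o) (m.incW y').1 = y'.1 := by
  show wrap m.P (wrap m.P (y'.1 + m.o) + -m.o) = y'.1
  rw [wrap_wrap_add, show y'.1 + m.o + -m.o = y'.1 by abel, wrap_of_mem m.P (m.boxDom_M_subset y'.2)]

/-- `□₂ ⊂ Λ₂′ − o` in the normalised position: `[0, M) ⊆ Λ₂′ − o mod P`. [cite: Balaban1982Higgs2, p. 572 «□ ⊂ B^k(Λ₂^{(k−1)′})»] -/
theorem hboxV : ∀ y : ↥(boxDom m.M), y.1 + (0 : Fin (d + 1) → ℤ) ∈ m.ΩV := by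
  intro y
  rw [add_zero]
  exact (mem_shiftLabels m.P (-m.o)).2 ⟨(m.incW y).1, (m.incW y).2, m.tlab_neg_incW y⟩

/-- `Λ₂′ − o` is a union of big blocks (`K ∣ o`). [cite: Balaban1983RegularityDecay, p. 575 «Ω is a sum of the corresponding large blocks»] -/
theorem hbigΩV : IsBlockUnion fr.KV1 m.ΩV :=
  isBlockUnion_shiftLabels m.P (-m.o) m.hΩP m.hK1 m.hKP (fun ν => by rw [Pi.neg_apply]; exact dvd_neg.2 (m.hKo ν))
    m.hbigΩ

/-- `□₂` in the normalised position is a union of big blocks (`K ∣ M`). [cite: Balaban1982Higgs2, p. 572 «the sums of large blocks»] -/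
theorem hbigBV : IsBlockUnion fr.KV1 (boxLabels m.M 0) := isBlockUnion_boxLabels_zero m.hK1 m.hKM

/-- a fine point of `Ω − o` translates into `Ω`. [cite: Balaban1983RegularityDecay, (1.1) p. 572, dictionary] -/
theorem tfin_o_mem {x : Fin (d + 1) → ℤ} (hx : x ∈ fineDom ((fr.ℓ + 1) ^ m.k) m.ΩV) :
    tfin m.P m.o ((fr.ℓ + 1) ^ m.k) x ∈ fineDom ((fr.ℓ + 1) ^ m.k) m.Ω₀T := by
  have h := tfin_mem_fineDom m.P m.o (hnk fr.ℓ m.k) hx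
  rwa [ΩV, shiftLabels_shiftLabels_neg m.P m.o m.hΩP] at h

/-- (2.23)/(1.7) for the translated field on `Ω − o` (from `hreg` on `Ω`: the torus differences relabel).
[cite: Balaban1983RegularityDecay, (1.7) p. 572; Balaban1982Higgs2, p. 571 sentence after (2.60)] -/
theorem hregV : ∀ x ∈ fineDom ((fr.ℓ + 1) ^ m.k) m.ΩV, ∀ μ ν : Fin (d + 1),
    |m.AcV (twrap ((fr.ℓ + 1) ^ m.k) m.P (x + e1 μ)) ν - m.AcV x ν| ≤ fr.creg * m.e ^ (fr.β - 1) / ((fr.ℓ + 1) ^ m.k : ℕ) := by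
  intro x hx μ ν
  have h := m.hreg _ (m.tfin_o_mem hx) μ ν
  simp only [AcV]
  rw [tfin_twrap_add]
  exact h

/-- the relabelled carried label is the box label in the normalised position. [cite: Balaban1982Higgs2, p. 572, dictionary] -/
theorem σY_incW (y' : ↥(boxDom m.M)) : σY m.P (-m.o) m.Ω₀T (m.incW y') = boxEmbY m.M 0 m.hboxV y' := by
  apply Subtype.ext
  rw [σY_val, tlab_neg_incW]
  exact (add_zero _).symm

/-- `□₁ ⊂ Λ₆′ − o` in the normalised position. [cite: Balaban1982Higgs2, (2.67) p. 572 «□₁φ», dictionary] -/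
theorem inc_memV : ∀ y' ∈ m.sq1, boxEmbY m.M 0 m.hboxV y' ∈ m.ToutV := by
  intro y' hy'
  rw [ToutV, Finset.mem_map]
  exact ⟨m.incW y', m.inc_mem y' hy', by rw [ιV_apply, σY_incW]⟩

/-- the outer sites off `□₁` stay at torus label distance `≥ R₂` after the translation (`tnorm` is blind to it).
[cite: Balaban1982Higgs2, (2.58) p. 570 «dist(b, y)», (2.67) p. 572, dictionary] -/
theorem farΩV : ∀ x : ↥(Box d fr.ℓ m.k m.M), blkSite d fr.ℓ m.k m.M x = m.y → ∀ y'' ∈ m.ToutV,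
    y'' ∉ m.sq1.image (boxEmbY m.M 0 m.hboxV) → m.R₂ ≤ tnorm 1 m.P ((blkSite d fr.ℓ m.k m.M x).1 + 0 - y''.1) := by
  intro x hx y'' hy'' hnot
  obtain ⟨y', hy', rfl⟩ := Finset.mem_map.1 hy''
  have hnot' : y' ∉ m.sq1.image (fun y₁ : ↥(boxDom m.M) => (⟨wrap m.P (y₁.1 + m.o), m.hbox y₁⟩ : ↥m.Ω₀T)) := by
    intro h
    apply hnot
    obtain ⟨y₁, hy₁, he⟩ := Finset.mem_image.1 h
    refine Finset.mem_image.2 ⟨y₁, hy₁, ?_⟩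
    rw [← σY_incW, ← he, ιV_apply]
    rfl
  have h := m.farΩ x hx y' hy' hnot'
  have hd : tnorm 1 m.P ((blkSite d fr.ℓ m.k m.M x).1 + 0 - (m.ιV y').1)
      = tnorm 1 m.P ((blkSite d fr.ℓ m.k m.M x).1 + m.o - y'.1) := by
    rw [ιV_apply, σY_val, tlab, tnorm_one_sub_wrap]
    congr 1
    funext ν
    simp only [Pi.sub_apply, Pi.add_apply, Pi.zero_apply, Pi.neg_apply]
    ring
  rw [hd]
  exact h

/-- **THE NORMALISED INSTANCE**: the torus translated by `−o` — `□₂` at the corner `0` (`0 ≤ 0`, `0 + M ≤ P`), outer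
labels `Λ₂′ − o`, field `A(· + L^ko)`, `φ(· + o)`, outer sites `Λ₆′ − o`; EVERY hypothesis of `ModelV` DERIVED from
`ModelW`'s (big-block unions translate since `K ∣ o`; (1.7) relabels; torus label distances are invariant).
[cite: Balaban1983RegularityDecay, p. 572 «a rectangular parallelepiped … with periodic conditions»; Balaban1982Higgs2, Lemma 2.4 p. 572] -/
def toModelV : ModelV fr where
  k := m.k
  hk := m.hk
  a := m.a
  m2 := m.m2
  ha1 := m.ha1
  ha2 := m.ha2
  hm1 := m.hm1
  hm2 := m.hm2
  M := m.M
  hM := m.hM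
  hMS := m.hMS
  hM3 := m.hM3
  P := m.P
  hKP := m.hKP
  o := 0
  ho0 := fun _ => le_rfl
  hoP := fun i => by rw [Pi.zero_apply, zero_add]; exact_mod_cast (m.hMP i).le
  hMP := m.hMP
  Ω₀T := m.ΩV
  hΩP := m.hΩV
  hbox := m.hboxV
  hbigΩ := m.hbigΩV
  hbigB := m.hbigBV
  e := m.e
  he := m.he
  hle := m.hle
  hleT := m.hleT
  hleR := m.hleR
  hθ1 := m.hθ1
  hτ1 := m.hτ1
  Ac := m.AcV
  hreg := m.hregV
  x₀ := m.x₀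
  y := m.y
  sq1 := m.sq1
  y_mem := m.y_mem
  φΩ := m.φV
  p := m.p
  q := m.q
  tφ := m.tφ
  R₁ := m.R₁
  R₂ := m.R₂
  R₄ := m.R₄
  p_nonneg := m.p_nonneg
  q_nonneg := m.q_nonneg
  tφ_nonneg := m.tφ_nonneg
  R₂_nonneg := m.R₂_nonneg
  q_le := m.q_le
  kap := m.kap
  sepG := m.sepG
  sepD := m.sepD
  sepO₂ := m.sepO₂
  sepO₄ := m.sepO₄
  θ_scale := m.θ_scale
  τ_scale := m.τ_scale
  θ'_scale := m.θ'_scale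
  far1 := m.far1
  Tout := m.ToutV
  inc_mem := m.inc_memV
  farΩ := m.farΩV
  R := m.R
  hR1 := m.hR1
  deep := m.deep
  hRT := m.hRT
  hR4 := m.hR4

/-! ## §4 The identifications: the normalised instance's kernel, fields and distances ARE the original torus objects -/

/-- THE TORUS PAIR `Ω ⊂ Ω` of the ORIGINAL data (for `G_k(Ω, A^{(k)})` on the untranslated torus). [cite: Balaban1982Higgs2, Prop. 2.2 (2.58) p. 570; Balaban1983RegularityDecay, (1.6) p. 572] -/
abbrev instOTW : TorusPairInst d fr.ℓ fr.amin fr.aplus fr.m2plus where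
  k := m.k
  hk := m.hk
  P := m.P
  hP := m.hP3.1
  h3 := m.hP3.2
  Ω₀T := m.Ω₀T
  ΩT := m.Ω₀T
  hbox := m.hΩP
  hsub := Finset.Subset.refl _
  a := m.a
  m2 := m.m2
  ha1 := m.ha1
  ha2 := m.ha2
  hm1 := m.hm1
  hm2 := m.hm2
  Ac := m.Ac
  e := m.e

/-- **THE FINE SITE `x + L^ko mod T_η` OF `□ = B^k(□₂)` INSIDE `Ω`** for a site `x` of the box lineage's `Π[0, L^kM)`.
[cite: Balaban1982Higgs2, p. 572 «□ = B^k(□₂) … □ ⊂ B^k(Λ₂^{(k−1)′})»; Balaban1983RegularityDecay, (1.1) p. 572] -/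
def EW (x : ↥(Box d fr.ℓ m.k m.M)) : ↥(fineDom ((fr.ℓ + 1) ^ m.k) m.Ω₀T) :=
  ⟨tfin m.P m.o ((fr.ℓ + 1) ^ m.k) x.1, by
    rw [mem_fineDom (hnk fr.ℓ m.k), blk_tfin m.P m.o (hnk fr.ℓ m.k)]
    exact m.hbox ⟨blk ((fr.ℓ + 1) ^ m.k) x.1, blk_mem_boxDom (hnk fr.ℓ m.k) x.2⟩⟩

/-- **THE OUTER KERNEL OF THE ORIGINAL TORUS DATA**: `K_Ω(x, y′) = a_k(G_k(Ω, A^{(k)})Q_k^*(A^{(k)}))(x + L^ko mod T, y′)`,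
`x ∈ Π[0, L^kM)`, `y′ ∈ Λ₂′` — r01's torus Green's function of `Ω` at the UNTRANSLATED field composed with `Q_k(A)ᵀ`.
[cite: Balaban1982Higgs2, (2.56) p. 570, (2.58) p. 570; Balaban1983RegularityDecay, (1.6) p. 572 «operators on subsets of a torus T_η»] -/
def KW (x : ↥(Box d fr.ℓ m.k m.M)) (y' : ↥m.Ω₀T) : Matrix ι ι ℝ :=
  Matrix.of fun i j => (m.ak • (m.instOTW.GT fr.F
    * (avgQ fr.F m.instOTW.κ (one_le_nT m.instOTW) m.Ω₀T (tbond m.instOTW m.Ω₀T))ᵀ)) (m.EW x, i) (y', j)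

/-- the translated field, translated back, is the field (on representatives). [cite: Balaban1983RegularityDecay, p. 572 «periodic conditions», dictionary] -/
theorem hAV : ∀ z ∈ boxDom (per ((fr.ℓ + 1) ^ m.k) m.P), m.AcV (tfin m.P (-m.o) ((fr.ℓ + 1) ^ m.k) z) = m.Ac z := by
  intro z hz
  show m.Ac (tfin m.P m.o _ (tfin m.P (-m.o) _ z)) = m.Ac z
  rw [tfin_tfin_neg m.P m.o hz]

/-- **THE EMBEDDED BOX SITE OF THE NORMALISED INSTANCE IS THE RELABELLED `x + L^ko mod T`**.
[cite: Balaban1982Higgs2, p. 572 «□ ⊂ B^k(Λ₂^{(k−1)′})»; Balaban1983RegularityDecay, (1.1) p. 572] -/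
theorem toModelV_ET (x : ↥(Box d fr.ℓ m.k m.M)) :
    m.toModelV.ET x = σT m.P (-m.o) (hnk fr.ℓ m.k) m.Ω₀T (m.EW x) := by
  apply Subtype.ext
  rw [σT_val]
  show (x.1 + fun i => (((fr.ℓ + 1) ^ m.k : ℕ) : ℤ) * (0 : Fin (d + 1) → ℤ) i) = tfin m.P (-m.o) _ (tfin m.P m.o _ x.1)
  rw [tfin_neg_tfin m.P m.o (m.box_subset_perBox x.2)]
  funext i
  simp

/-- **THE TORUS TRANSLATION LEMMA APPLIED — THE NORMALISED INSTANCE'S OUTER KERNEL IS THE ORIGINAL ONE**: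
`K_Ω^{norm}(x, y′ − o mod P) = a_k(G_k(Ω, A^{(k)})Q_k^*(A^{(k)}))(x + L^ko mod T, y′) = K_Ω(x, y′)` (`greenQ_shift_apply`
with `t = −o`). [cite: Balaban1982Higgs2, (2.56) p. 570, (2.58) p. 570, Lemma 2.4 p. 572; Balaban1983RegularityDecay,
(1.4)–(1.6) p. 572 «operators on subsets of a torus T_η … with periodic conditions»] -/
theorem toModelV_KΩT (x : ↥(Box d fr.ℓ m.k m.M)) (y' : ↥m.Ω₀T) :
    m.toModelV.KΩT x (σY m.P (-m.o) m.Ω₀T y') = m.KW x y' := by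
  ext i j
  simp only [ModelV.KΩT, KW, Matrix.of_apply, Matrix.smul_apply]
  rw [toModelV_ET]
  exact congrArg (fun r : ℝ => m.ak • r)
    (greenQ_shift_apply (hnk fr.ℓ m.k) m.P m.hP3.1 (-m.o) m.hΩP m.Ac m.AcV m.hAV fr.F m.e m.ak m.m2 (m.EW x) y' i j)

/-- `K_Ω(x, y′)v = a_k·(G_k(Ω, A^{(k)})f_{y′,v})(x + L^ko mod T)` with the torus source `f_{y′,v} = Q_k^*(A)(vδ_{y′})` of
the ORIGINAL data. [cite: Balaban1982Higgs2, (2.56) p. 570, (2.58) p. 570] -/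
theorem KW_mulVec (x : ↥(Box d fr.ℓ m.k m.M)) (y' : ↥m.Ω₀T) (v : ι → ℝ) :
    m.KW x y' *ᵥ v = m.ak • fld (m.instOTW.GT fr.F *ᵥ tsrc fr.F m.instOTW y' v) (m.EW x) := by
  rw [KW, tsrc, ← fld_mul_avgQ_transpose_mulVec_single, ← block_mulVec_eq_fld, ← Matrix.smul_mulVec]
  rfl

/-- **THE BOX SEES `A^{(k)}_per(· + L^ko)`**: the normalised instance's box field is the original field translated by
`L^ko` and periodically extended. [cite: Balaban1982Higgs2, (2.67) p. 572; Balaban1983RegularityDecay, p. 572 «periodic conditions»] -/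
theorem toModelV_AcP : m.toModelV.AcP = m.AcPW := by
  funext z
  show m.Ac (tfin m.P m.o _ (twrap ((fr.ℓ + 1) ^ m.k) m.P
      (z + fun i => (((fr.ℓ + 1) ^ m.k : ℕ) : ℤ) * (0 : Fin (d + 1) → ℤ) i)))
    = m.Ac (twrap ((fr.ℓ + 1) ^ m.k) m.P (z + fun i => (((fr.ℓ + 1) ^ m.k : ℕ) : ℤ) * m.o i))
  rw [tfin, twrap_twrap_add]
  congr 2
  funext i
  simp

/-- **`φ` IS READ AT `(y′ + o) mod P`**: the normalised instance's `φ ∘ inc` is the original `φ` at the carried label.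
[cite: Balaban1982Higgs2, (2.56) p. 570 «Λ₆^{(k−1)′}φ», (2.65) p. 572 «φ(y)»] -/
theorem toModelV_φ (y' : ↥(boxDom m.M)) : m.toModelV.φΩ (m.toModelV.incT y') = m.φΩ (m.incW y') := by
  show m.φV (boxEmbY m.M 0 m.hboxV y') = m.φΩ (m.incW y')
  unfold φV
  congr 1
  apply Subtype.ext
  show tlab m.P m.o (y'.1 + 0) = wrap m.P (y'.1 + m.o)
  rw [add_zero]
  rfl

/-- **THE LABEL DISTANCE IS `|y(x) + o − y′|_{T_1}`** on the original torus. [cite: Balaban1982Higgs2, (2.58) p. 570 «dist(b, y)», dictionary] -/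
theorem toModelV_dLT (x : ↥(Box d fr.ℓ m.k m.M)) (y' : ↥m.Ω₀T) :
    m.toModelV.dLT x (σY m.P (-m.o) m.Ω₀T y') = tnorm 1 m.P ((blkSite d fr.ℓ m.k m.M x).1 + m.o - y'.1) := by
  show tnorm 1 m.P ((blkSite d fr.ℓ m.k m.M x).1 + 0 - tlab m.P (-m.o) y'.1) = _
  rw [tlab, tnorm_one_sub_wrap]
  congr 1
  funext ν
  simp only [Pi.sub_apply, Pi.add_apply, Pi.zero_apply, Pi.neg_apply]
  ring

/-- `φ` relabelled and read back is `φ`. [cite: Balaban1982Higgs2, (2.56) p. 570 «Λ₆^{(k−1)′}φ», dictionary] -/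
theorem φV_σY (y' : ↥m.Ω₀T) : m.φV (σY m.P (-m.o) m.Ω₀T y') = m.φΩ y' := by
  unfold φV
  congr 1
  apply Subtype.ext
  show tlab m.P m.o (tlab m.P (-m.o) y'.1) = y'.1
  exact tlab_tlab_neg m.P m.o (m.hΩP y'.2)

/-- **THE (2.56) FIELD OF THE NORMALISED INSTANCE IS THE ORIGINAL ONE**: `Σ_{y″ ∈ Λ₆′−o} K_Ω^{norm}(x, y″)φ^{norm}(y″)
= Σ_{y′ ∈ Λ₆′} K_Ω(x, y′)φ(y′)` — the value `φ^{(k)}(x + L^ko mod T)` of `a_kG_k(Ω,A^{(k)})Q_k^*(A^{(k)})Λ₆′φ` on the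
ORIGINAL torus (this sum is the `φk` of `B2Lemma24Proof.Model` along `toModelT`, whose suprema are `dev265a/b`, `dev266`).
[cite: Balaban1982Higgs2, (2.56) p. 570 «φ^{(k)} = a_kG_k(B^k(Λ₂^{(k−1)′}), A^{(k)})Q_k^*(A^{(k)})Λ₆^{(k−1)′}φ», Lemma 2.4 (2.65) p. 572] -/
theorem toModelV_φk (x : ↥(Box d fr.ℓ m.k m.M)) :
    ∑ y'' ∈ m.toModelV.Tout, m.toModelV.KΩT x y'' *ᵥ m.toModelV.φΩ y'' = ∑ y' ∈ m.Tout, m.KW x y' *ᵥ m.φΩ y' := by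
  show ∑ y'' ∈ m.ToutV, m.toModelV.KΩT x y'' *ᵥ m.φV y'' = _
  rw [ToutV, Finset.sum_map]
  refine Finset.sum_congr rfl fun y' _ => ?_
  rw [ιV_apply, toModelV_KΩT, φV_σY]

/-! ### The four (2.58) kernel bounds for the original torus kernel -/

/-- **(2.58) FOR `G_k(Ω,A^{(k)})Q_k^*(A^{(k)})` ON THE ORIGINAL TORUS, `□₂` IN ARBITRARY POSITION**: for `x ∈ B^k(y)` and
every `y′ ∈ Λ₂′`, `|K_Ω(x,y′)v| ≤ cO·e^{−δO|y(x)+o−y′|_{T_1}}|v|`. [cite: Balaban1982Higgs2, Prop. 2.2 (2.58) p. 570, (2.67) p. 572] -/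
theorem kerΩ_far_W (x : ↥(Box d fr.ℓ m.k m.M)) (hx : blkSite d fr.ℓ m.k m.M x = m.y) (y' : ↥m.Ω₀T) (v : ι → ℝ) :
    siteNorm (m.KW x y' *ᵥ v)
      ≤ fr.cO * Real.exp (-(fr.δO * tnorm 1 m.P ((blkSite d fr.ℓ m.k m.M x).1 + m.o - y'.1))) * siteNorm v := by
  rw [← toModelV_KΩT, ← toModelV_dLT]
  exact m.toModelV.kerΩ_far x hx _ v

/-- **(2.58) FOR `D^η_AG_k(Ω,A^{(k)})Q_k^*(A^{(k)})` ON THE ORIGINAL TORUS**: on every bond `(x, x+e_μ) ⊂ □` with `x ∈ B^k(y)`,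
`|(D^η_{A,μ}K_Ω)(b,y′)v| ≤ cO·e^{−δO|y(x)+o−y′|_{T_1}}|v|` (the box-side link at `A^{(k)}_per(· + L^ko)`).
[cite: Balaban1982Higgs2, Prop. 2.2 (2.58) p. 570, (2.67) p. 572 «the same equality for the covariant derivative»] -/
theorem dkerΩ_far_W (μ : Fin (d + 1)) (x : ↥(Box d fr.ℓ m.k m.M)) (hx : blkSite d fr.ℓ m.k m.M x = m.y)
    (h : x.1 + e1 μ ∈ Box d fr.ℓ m.k m.M) (y' : ↥m.Ω₀T) (v : ι → ℝ) :
    siteNorm (dKer d fr.F (κS fr.ℓ m.k m.e) fr.ℓ m.k m.M (fun u w => compField m.AcPW u.1 w.1) m.KW μ x h y' *ᵥ v)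
      ≤ fr.cO * Real.exp (-(fr.δO * tnorm 1 m.P ((blkSite d fr.ℓ m.k m.M x).1 + m.o - y'.1))) * siteNorm v := by
  have hK : dKer d fr.F (κS fr.ℓ m.k m.e) fr.ℓ m.k m.M (fun u w => compField m.toModelV.AcP u.1 w.1) m.toModelV.KΩT μ x h
        (σY m.P (-m.o) m.Ω₀T y')
      = dKer d fr.F (κS fr.ℓ m.k m.e) fr.ℓ m.k m.M (fun u w => compField m.AcPW u.1 w.1) m.KW μ x h y' := by
    rw [dKer, dKer, toModelV_KΩT, toModelV_KΩT, toModelV_AcP]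
  rw [← hK, ← toModelV_dLT]
  have h0 := m.toModelV.dkerΩ_far μ x hx h (σY m.P (-m.o) m.Ω₀T y') v
  rw [constBond_add_AprS] at h0
  exact h0

/-- the normalised instance's label embedding is the relabelled carried label. [cite: Balaban1982Higgs2, p. 572 «□ ⊂ B^k(Λ₂^{(k−1)′})», dictionary] -/
theorem toModelV_incT (y' : ↥(boxDom m.M)) : m.toModelV.incT y' = σY m.P (-m.o) m.Ω₀T (m.incW y') :=
  (m.σY_incW y').symm

/-- **(2.58) FOR `δG_k(□,Ω,A^{(k)})Q_k^*(A^{(k)})` ON THE ORIGINAL TORUS**: for `x ∈ B^k(y)` and `y′ ∈ □₂` (carried label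
`(y′ + o) mod P`), `|(K_Ω(x, (y′+o) mod P) − K_□(x, y′))v| ≤ cO·e^{−δO R₄}·e^{−δO|y(x)+o−((y′+o) mod P)|_{T_1}}|v|`, the box
kernel `K_□` at the field `A^{(k)}_per(· + L^ko)`. [cite: Balaban1982Higgs2, Prop. 2.2 p. 571 «δG_k(Ω, Ω₀, A)Q_k^*(A) with
the additional factor», (2.67) p. 572] -/
theorem kerΩ_near_W (x : ↥(Box d fr.ℓ m.k m.M)) (hx : blkSite d fr.ℓ m.k m.M x = m.y) (y' : ↥(boxDom m.M)) (v : ι → ℝ) :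
    siteNorm ((m.KW x (m.incW y') - kerBox d fr.F (κS fr.ℓ m.k m.e) fr.ℓ m.k m.a m.m2 m.M (embS d fr.ℓ m.k m.M)
        (ΓS d fr.ℓ m.k m.M) (A0S d m.AcPW m.x₀) (AprS d fr.ℓ m.k m.M (A0S d m.AcPW m.x₀) m.AcPW) x y') *ᵥ v)
      ≤ fr.cO * Real.exp (-(fr.δO * m.R₄))
          * Real.exp (-(fr.δO * tnorm 1 m.P ((blkSite d fr.ℓ m.k m.M x).1 + m.o - (m.incW y').1))) * siteNorm v := by
  rw [← toModelV_KΩT, ← toModelV_dLT, ← toModelV_incT, ← toModelV_AcP]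
  exact m.toModelV.kerΩ_near x hx y' v

/-- **(2.58) FOR `D^η_AδG_k(□,Ω,A^{(k)})Q_k^*(A^{(k)})` ON THE ORIGINAL TORUS**. [cite: Balaban1982Higgs2, Prop. 2.2 p. 571
«D^η_AδG_k(Ω, Ω₀, A)Q_k^*(A) … with the additional factor», (2.67) p. 572] -/
theorem dkerΩ_near_W (μ : Fin (d + 1)) (x : ↥(Box d fr.ℓ m.k m.M)) (hx : blkSite d fr.ℓ m.k m.M x = m.y)
    (h : x.1 + e1 μ ∈ Box d fr.ℓ m.k m.M) (y' : ↥(boxDom m.M)) (v : ι → ℝ) :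
    siteNorm ((dKer d fr.F (κS fr.ℓ m.k m.e) fr.ℓ m.k m.M
        (constBond (A0S d m.AcPW m.x₀) Subtype.val + AprS d fr.ℓ m.k m.M (A0S d m.AcPW m.x₀) m.AcPW) m.KW μ x h (m.incW y')
      - dkerBox d fr.F (κS fr.ℓ m.k m.e) fr.ℓ m.k m.a m.m2 m.M (embS d fr.ℓ m.k m.M) (ΓS d fr.ℓ m.k m.M)
          (A0S d m.AcPW m.x₀) (AprS d fr.ℓ m.k m.M (A0S d m.AcPW m.x₀) m.AcPW) μ x y') *ᵥ v)
      ≤ fr.cO * Real.exp (-(fr.δO * m.R₄))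
          * Real.exp (-(fr.δO * tnorm 1 m.P ((blkSite d fr.ℓ m.k m.M x).1 + m.o - (m.incW y').1))) * siteNorm v := by
  have hK : dKer d fr.F (κS fr.ℓ m.k m.e) fr.ℓ m.k m.M
        (constBond (A0S d m.toModelV.AcP m.x₀) Subtype.val + AprS d fr.ℓ m.k m.M (A0S d m.toModelV.AcP m.x₀) m.toModelV.AcP)
        m.toModelV.KΩT μ x h (σY m.P (-m.o) m.Ω₀T (m.incW y'))
      = dKer d fr.F (κS fr.ℓ m.k m.e) fr.ℓ m.k m.M
          (constBond (A0S d m.AcPW m.x₀) Subtype.val + AprS d fr.ℓ m.k m.M (A0S d m.AcPW m.x₀) m.AcPW) m.KW μ x h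
          (m.incW y') := by
    rw [dKer, dKer, toModelV_KΩT, toModelV_KΩT, toModelV_AcP]
  rw [← hK, ← toModelV_dLT, ← toModelV_incT, ← toModelV_AcP]
  exact m.toModelV.dkerΩ_near μ x hx h y' v

end ModelW

/-! ### Row B2.Lem2.4 for the family with `□₂` in arbitrary position on the torus -/

/-- the row's carrier filled by an instance with `□₂` anywhere on `T_η`: that of its normalised translate (restrictions
(2.55), the three suprema of (2.65)/(2.66) of `φ^{(k)} = a_kG_k(Ω,A^{(k)})Q_k^*(A^{(k)})φ` of (2.56) on the ORIGINAL torus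
data read through the relabelling — §4 —, the scale `p(L^kε)`). [cite: Balaban1982Higgs2, Lemma 2.4 (2.65)–(2.66) p. 572, (2.56) p. 570] -/
def famOfW (fr : FrameV ι d) (m : ModelW fr) : B2.L24Setting := famOfV fr m.toModelV

/-- **ROW B2.Lem2.4 — LEMMA 2.4 (2.65)–(2.66), THE DECL OF RECORD `B2.Lemma24Printed`, FOR THE TORUS FAMILY WITH `□₂`
IN ARBITRARY POSITION** (outer region `Ω = B^k(Λ₂′) ⊂ T_η` any union of big blocks, the whole torus included; the
representative of `□₂` may cross the seam of the period box — the seam normalisation is the kernel's `toModelV`): one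
constant `C` per frame (the twin's, a function of `fr.toFrame` alone) and `dev265a, dev265b, dev266 ≤ C·p(L^kε)` for
every instance obeying (2.55). [cite: Balaban1982Higgs2, Lemma 2.4 (2.65)–(2.66) p. 572; proof (2.67)–(2.77) pp. 572–574;
Prop. 2.2 (2.58) pp. 570–571] [cite: Balaban1983RegularityDecay, Theorem p. 573, p. 572 «a rectangular parallelepiped … with periodic conditions»] -/
theorem lemma24Printed_modelW (fr : FrameV ι d) : B2.Lemma24Printed (famOfW fr) := by
  obtain ⟨C, h⟩ := lemma24Printed_modelV fr
  exact ⟨C, fun m hR => h m.toModelV hR⟩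

end Instance

/-! ## §5 (v1.1, append-only) The source `f_{y,v} = Q_k^*(A)(vδ_y)` and `G_k f` under the relabelling, by name -/

section Sources

variable {n : ℕ} (hn : 1 ≤ n) (P : Fin (d + 1) → ℕ) (hP : ∀ ν, 1 ≤ P ν) (t : Fin (d + 1) → ℤ)
  {Ω : Finset (Fin (d + 1) → ℤ)} (hΩ : Ω ⊆ boxDom P)
  (Ac Ac' : (Fin (d + 1) → ℤ) → Fin (d + 1) → ℝ) (hA : ∀ z ∈ boxDom (per n P), Ac' (tfin P t n z) = Ac z)

include hP hΩ hA in
/-- **THE SOURCE `f_{y,v} = Q_k^*(A)(vδ_y)` RELABELS**: `f′_{σy,v}(σx) = f_{y,v}(x)` (p23 g14's `srcQ`; block weight and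
transporter relabel). [cite: Balaban1982Higgs2, Prop. 2.2 p. 570 «Q_k^*(A)»; Balaban1983RegularityDecay, (1.4) p. 572, p. 572 «periodic conditions»] -/
theorem fld_srcQ_shift (F : OrthFlow ι) (κ : ℝ) (y : ↥Ω) (v : ι → ℝ) (x : ↥(fineDom n Ω)) :
    fld (srcQ F κ hn (shiftLabels P t Ω) (fun a b : ↥(fineDom n (shiftLabels P t Ω)) => torBond n P Ac' a.1 b.1)
        (σY P t Ω y) v) (σT P t hn Ω x)
      = fld (srcQ F κ hn Ω (fun a b : ↥(fineDom n Ω) => torBond n P Ac a.1 b.1) y v) x := by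
  rw [B2Prop22RegularRegionPair.fld_srcQ, B2Prop22RegularRegionPair.fld_srcQ, rBlkWt_shift hn P t hΩ,
    contourTrans_shift hn P hP t hΩ Ac Ac' hA]

include hP hΩ hA in
/-- the same as an identity of site functions: `f′_{σy,v} ∘ σ = f_{y,v}`. [cite: Balaban1982Higgs2, Prop. 2.2 p. 570 «Q_k^*(A)», dictionary] -/
theorem srcQ_shift (F : OrthFlow ι) (κ : ℝ) (y : ↥Ω) (v : ι → ℝ) :
    (fun p : ↥(fineDom n Ω) × ι => srcQ F κ hn (shiftLabels P t Ω)
        (fun a b : ↥(fineDom n (shiftLabels P t Ω)) => torBond n P Ac' a.1 b.1) (σY P t Ω y) v (σT P t hn Ω p.1, p.2))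
      = srcQ F κ hn Ω (fun a b : ↥(fineDom n Ω) => torBond n P Ac a.1 b.1) y v := by
  funext p
  exact congrFun (fld_srcQ_shift hn P hP t hΩ Ac Ac' hA F κ y v p.1) p.2

include hP hΩ hA in
/-- **`G_k(Ω + t, A′)Φ` READ AT `σx` IS `G_k(Ω, A)(Φ ∘ σ)` AT `x`** (the Green's function as an operator, not only entrywise).
[cite: Balaban1983RegularityDecay, (1.6) p. 572 «G_k(Ω, A)», p. 572 «periodic conditions»] -/
theorem fld_green_mulVec_shift (F : OrthFlow ι) (e a m2 : ℝ) (Φ : ↥(fineDom n (shiftLabels P t Ω)) × ι → ℝ)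
    (x : ↥(fineDom n Ω)) :
    fld ((torusOp F e hn a m2 P (shiftLabels P t Ω) Ac')⁻¹ *ᵥ Φ) (σT P t hn Ω x)
      = fld ((torusOp F e hn a m2 P Ω Ac)⁻¹ *ᵥ fun p => Φ (σT P t hn Ω p.1, p.2)) x := by
  funext i
  rw [fld_apply, fld_apply, ← green_shift hn P hP t hΩ Ac Ac' hA F e a m2, ← σTι_eq P t hn hΩ hP,
    show (fun p : ↥(fineDom n Ω) × ι => Φ (σT P t hn Ω p.1, p.2)) = Φ ∘ (σTι ι P t hn hΩ hP) from rfl,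
    Matrix.submatrix_mulVec_equiv, Function.comp_assoc, Equiv.self_comp_symm, Function.comp_id]
  rfl

include hP hΩ hA in
/-- **`(G_k(Ω + t, A′)f′_{σy,v})(σx) = (G_k(Ω, A)f_{y,v})(x)`** — the (2.58) object `G_k(Ω,A)Q_k^*(A)` at a point and a
label, relabelled. [cite: Balaban1982Higgs2, Prop. 2.2 (2.58) p. 570; Balaban1983RegularityDecay, (1.4)–(1.6) p. 572] -/
theorem fld_green_srcQ_shift (F : OrthFlow ι) (e a m2 : ℝ) (y : ↥Ω) (v : ι → ℝ) (x : ↥(fineDom n Ω)) :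
    fld ((torusOp F e hn a m2 P (shiftLabels P t Ω) Ac')⁻¹ *ᵥ srcQ F (e / n) hn (shiftLabels P t Ω)
        (fun a b : ↥(fineDom n (shiftLabels P t Ω)) => torBond n P Ac' a.1 b.1) (σY P t Ω y) v) (σT P t hn Ω x)
      = fld ((torusOp F e hn a m2 P Ω Ac)⁻¹ *ᵥ srcQ F (e / n) hn Ω (fun a b : ↥(fineDom n Ω) => torBond n P Ac a.1 b.1) y v)
          x := by
  rw [fld_green_mulVec_shift hn P hP t hΩ Ac Ac' hA, srcQ_shift hn P hP t hΩ Ac Ac' hA]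

end Sources

section InstanceSources

variable [Nonempty ι] {d : ℕ}

namespace ModelW

variable {fr : FrameV ι d} (m : ModelW fr)

/-- **THE TORUS SOURCE OF THE NORMALISED INSTANCE IS THE ORIGINAL ONE**: `tsrc` of the translated pair `Ω−o ⊂ Ω−o` at the
relabelled label and site = `tsrc` of the original pair `Ω ⊂ Ω` (r01's `TorusPairInst`, p23 g14's `tsrc`).
[cite: Balaban1982Higgs2, Prop. 2.2 p. 570 «Q_k^*(A)»; Balaban1983RegularityDecay, (1.4) p. 572] -/
theorem toModelV_tsrc (y' : ↥m.Ω₀T) (v : ι → ℝ) (x : ↥(fineDom ((fr.ℓ + 1) ^ m.k) m.Ω₀T)) :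
    fld (tsrc fr.F m.toModelV.instOT (σY m.P (-m.o) m.Ω₀T y') v) (σT m.P (-m.o) (hnk fr.ℓ m.k) m.Ω₀T x)
      = fld (tsrc fr.F m.instOTW y' v) x :=
  fld_srcQ_shift (hnk fr.ℓ m.k) m.P m.hP3.1 (-m.o) m.hΩP m.Ac m.AcV m.hAV fr.F _ y' v x

/-- **`(G_k(Ω−o, A^{norm})f^{norm}_{σy′,v})(σx) = (G_k(Ω, A^{(k)})f_{y′,v})(x)`** at every site of `Ω` (not only on `□`):
the (2.58) object of the normalised instance is the original one. [cite: Balaban1982Higgs2, Prop. 2.2 (2.58) p. 570, (2.56) p. 570] -/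
theorem toModelV_green_tsrc (y' : ↥m.Ω₀T) (v : ι → ℝ) (x : ↥(fineDom ((fr.ℓ + 1) ^ m.k) m.Ω₀T)) :
    fld (m.toModelV.instOT.GT fr.F *ᵥ tsrc fr.F m.toModelV.instOT (σY m.P (-m.o) m.Ω₀T y') v)
        (σT m.P (-m.o) (hnk fr.ℓ m.k) m.Ω₀T x)
      = fld (m.instOTW.GT fr.F *ᵥ tsrc fr.F m.instOTW y' v) x :=
  fld_green_srcQ_shift (hnk fr.ℓ m.k) m.P m.hP3.1 (-m.o) m.hΩP m.Ac m.AcV m.hAV fr.F m.e m.ak m.m2 y' v x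

end ModelW

end InstanceSources

end

end Literature.MathematicalPhysics.QuantumFieldTheory.Balaban1983to89.B2Lemma24KerOmegaTorusShift
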